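import Mathlib.FieldTheory.IsAlgClosed.Basic
import Mathlib.Algebra.Polynomial.Roots
import Literature.Computability.AlgebraicComplexity.OrbitClosureProofs
import Literature.Computability.AlgebraicComplexity.DeterminantUniversalityBCSProofs
import Literature.Computability.AlgebraicComplexity.PolystabilityProofs
import Literature.Computability.AlgebraicComplexity.CharacterizedByStabilizerSL
import Literature.NumberTheory.DiophantineGeometry.DetStabilizerKronecker
import HarnessLib

/-!
# Mulmuley–Sohoni, *Geometric Complexity Theory I* (SIAM J. Comput. 31, 2001), §4–§7 — typed as printed

K. D. Mulmuley, M. Sohoni, *Geometric complexity theory I: an approach to the P vs. NP and related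
problems*, SIAM J. Comput. **31** (2001) 496–526 [bib `MulmuleySohoniSIAM2001`]. Typed literature
(cell val-lit, DAG row MS2001-A, bears_on V3); honest framing: VP ≠ VNP is NOT proved and nothing in
this file is progress on it.

## Text of record and locators

The journal version is not held (acq-00432, cite-only). Every statement below is typed from the
AUTHORS' VERSION dated 2001-04-23 (dvips `part1.dvi`, 40 pp., staged as
`pub-gct/inputs/files/mulmuley-sohoni2001-gct1-authorversion.ps`; decoded text of record
`run/shared/lean/pub/val-lit/bip/texts/MS2001-authorversion/{pNN.txt, all.txt}`), cited as
`AV p.N (all.txt Lnnnn)`; DECLARATION NAMES ARE KEYED TO THE AV NUMBERS. The AV uses one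
counter per section (Prop. 4.1, Prop. 4.2, Conj. 4.3, Prop. 4.4, Prop. 4.5, Thms. 4.6–4.8; Thm. 5.1,
Ex. 5.2.1, Ex. 5.3.1, Thm. 5.2, Prop. 5.3, Thms. 5.4–5.5; Props. 6.1–6.2; Props. 7.1–7.2,
Thms. 7.3–7.4, Conj. 7.5–7.6, Prop. 7.7, Conj. 7.8, Prop. 7.9, Conj. 7.10–7.11).
JOURNAL NUMBERING (inferred; the journal is not held): the secondary citations of the journal
version are consistent with its THEOREMS being numbered by a separate counter, while propositions,
conjectures and examples keep the AV numbers — Regan, *Understanding the Mulmuley–Sohoni approach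
to P vs. NP*, Bull. EATCS 78 (2002) [bib `Regan2002`] cites "[MS02] Props. 4.1 and 4.4" (formula
size ⇒ orbit closure; the converse approximation = AV Props. 4.1, 4.4), "Conjecture 4.3" (= AV
Conj. 4.3; so also Adsul–Sohoni–Subrahmanyam 2023), "Theorem 4.3 in [MS02]" for the partial
stability of the padded permanent (= AV Thm. 4.8, the third theorem of §4), "Theorem 5.1" (= AV
Thm. 5.1), "Theorem 5.3 … it still requires `f` to be stable" (= AV Thm. 5.4, the third theorem of
§5), "5.3.1 Example 2"; and Bürgisser–Landsberg–Manivel–Weyman 2011 (arXiv:0907.2850 §4.1) cite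
"[MS1], Theorem 4.1" for "`GL(W)(det_n)` does not contain any parabolic subgroup" (= the proof of
AV Thm. 4.6, the first theorem of §4). Hence, presumably: journal Thm. 4.1 = AV Thm. 4.6
(`MS2001_thm_4_6`), journal Thm. 4.2 = AV Thm. 4.7 (`MS2001_thm_4_7`), journal Thm. 4.3 = AV
Thm. 4.8, journal Thm. 5.3 = AV Thm. 5.4, journal Thm. 5.4 = AV Thm. 5.5, journal Thm. 7.1 = AV
Thm. 7.3 (`MS2001_thm_7_3`), journal Thm. 7.2 = AV Thm. 7.4; Props. 4.1, 4.2, 4.4, 4.5, 7.1, 7.2,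
Conj. 4.3, Thm. 5.1 and the Examples coincide. Every cite tag below gives the AV number and, for
the theorems, the inferred journal number.

## What is typed here, and what is CITED instead (cell file `bip/CHECK-t01.md` has the full table)

* **Prop. 4.1** (formula of size `l` ⇒ padded form in `Δ[det_m]`): PROVED (`MS2001_prop_4_1`) from
  the tree's determinant universality with the BCS constant `m ≥ 2u + 2` (`u` = expression size,
  `ArithExpr.isDetProjection_eval`) — the print has `m = 2l` from Valiant [45]; the orbit-closure
  membership is monotone in `m`, so the typed constant is the only deviation.
* **Prop. 4.2** (`det(Y)` is characterized by its stabilizer `R ⊂ SL_{m²}(F)`, `F` algebraically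
  closed of ARBITRARY characteristic): named fact `MS2001_prop_4_2` in the authors' own later
  formalization of "characterized by its stabilizer" (GCT II §1: `V^{G_v̂} = ℂ v`, tree
  `IsCharacterizedByStabilizerIn`); its characteristic-zero case is PROVED for every field
  (`MS2001_prop_4_2_of_charZero`, from `CharacterizedByStabilizer.detPoly_eq_smul_of_fixed_of_det_eq_one`;
  the tree's `isCharacterizedByStabilizerIn_slSubgroup_detPoly` is the instance `F = ℂ`).
* **Conj. 4.3** is the tree's `MulmuleySohoniConjecture` (`GCT.lean`, `@[conjecture]`, CITED, never
  asserted). PRINT FACT recorded here: GCT I states it with the POLYNOMIAL window "`m = n^a`, `a` any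
  fixed constant", over an algebraically closed `F` of arbitrary characteristic, for `G = SL_{m²}(F)`
  on `P(V)` (the quasi-polynomial window `2^{polylog}` is GCT II's / the GCT Introduction's).
* **Prop. 4.4** (`F = ℂ`; ¬Conj. 4.3 ⇒ `perm` is approximated infinitesimally closely by formulas of
  size `n^{O(log n)}`): CITED in substance — Zariski = Euclidean closure
  (`orbitClosure_eq_euclidean_closure_complex_holds`) and `IsInteriorLimitPoint.hasDetRepr` below;
  the "approximating formula" phrasing needs a border-formula notion the tree does not have.
* **Prop. 4.5** (`perm(X)` characterized by its stabilizer `K ⊂ SL_{k²}(F)`): CITED —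
  `perPoly_isCharacterizedByStabilizer_holds` (GL reading, PROVED) and, for the printed `SL` reading,
  `isCharacterizedByStabilizerIn_slSubgroup_perPoly_iff` (PROVED for `k ≢ 1 (mod 4)`, REFUTED by
  `not_isCharacterizedByStabilizerIn_slSubgroup_perPoly` for `k ≡ 1 (mod 4)`, `k ≥ 5`): an erratum
  against the printed "The proof is easy", now located in GCT I itself (AV p.14).
* **Thms. 4.6, 4.7** (`det(Y)`, `perm(X)` are STABLE = closed `SL`-orbit, over an algebraically
  closed field of arbitrary characteristic): named facts `MS2001_thm_4_6`, `MS2001_thm_4_7`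
  (`IsPolystable`); the case `F = ℂ` is the tree's PROVED `BurgisserIkenmeyer2017_polystable_det_per_holds`
  (det clause already aliased as `Bur24_thm_7_2`, CITED; per clause restated in printed shape as
  `MS2001_thm_4_7_complex`). The one mathematical claim of the two printed PROOFS — the stabilizer
  `R ⊂ SL_{m²}` of `det(Y)`, resp. of `perm(X)`, acts IRREDUCIBLY on the space of matrices (whence
  it lies in no proper parabolic and Kempf's criterion applies; Kempf's criterion itself is not in
  the tree) — is PROVED at the end of this file for the defining action on coordinate vectors:
  `MS2001_detStabilizer_irreducible` (any field, any `m`; Kronecker transvections) and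
  `MS2001_perStabilizer_irreducible` (any infinite field; torus scalings and even row/column
  permutations).
* **§4.1 remark** (AV p.16, all.txt L1062–1065): "`perm^φ(Y)` … is not stable … it belongs to
  the null cone" — CITED: PROVED in the tree as `paddedPerPoly_not_isSLSemistable` /
  `paddedPerPoly_inNullCone` / `paddedPerPoly_not_isPolystable` (`MS08Obstructions.lean`, typed from
  GCT II §2's restatement, landed the same hour; `n < m`, `2 ≤ m`, any infinite field). The first
  version of this file carried its own `IsInNullCone` / `MS2001_paddedPerPoly_isInNullCone` for the
  same remark; they are withdrawn here in favour of those declarations (no importer used them).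
* **Thm. 4.8** (journal Thm. 4.3; padded permanent partially stable with defect `δ = 1`) and Def. §3.1 (partial
  stability via Kempf flags): NOT typed — the notion is absent from the tree (GCT II Def. 2.1 makes it
  definitional from Thm. 4.7); recorded in CHECK-t01.md.
* **§4.2** interior / exterior limit points of `Δ[g]`: DEFINED (`IsInteriorLimitPoint`,
  `IsExteriorLimitPoint`) over the tree's `endOrbit` / `orbitClosure`, with the printed remarks as
  lemmas (`IsInteriorLimitPoint.mem_orbitClosure`, `.hasDetRepr` = "interior limit points have
  small formulae" in dc-form, the dichotomy).
* **§5 Thm. 5.1** (characteristic zero; Luna-slice obstruction criterion): named fact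
  `MS2001_thm_5_1`, typed for the concrete family of representations `W = Sym^r(X)` = forms of degree
  `r` under linear substitution (the case used in Ex. 5.2.1), `TODO(general form)`: all finite
  dimensional rational `G`-modules.
* **Ex. 5.2.1** (`perm_d ∉ Δ[det_d]`): CITED — PROVED in the tree route-side
  (`Summit.…Theorems.NoValuativeFlip.not_hasBorderDetRepr_self`, `d ≥ 3`; not importable into
  Literature).
* **Ex. 5.3.1** ("Example 2", [38] Popov–Vinberg): `x²y ∈ Δ[x³ + y³]` PROVED (`MS2001_example_5_3_1`)
  by an explicit degeneration, via the general one-parameter-family lemma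
  `map_eval_zero_mem_orbitClosure_of_family` (any infinite field), itself from
  `coeffVec_map_eval_zero_mem_zariskiClosure_of_family`.
* Illustration (ours): `x²y` is an EXTERIOR limit point of `Δ[x³ + y³]`
  (`MS2001_example_5_3_1_isExteriorLimitPoint`: not a linear-substitution instance — a
  Nullstellensatz certificate), so Def. §4.2 is non-vacuous.
* **Thm. 5.2, Prop. 5.3, Thms. 5.4, 5.5** (positive characteristic Luna; sheaf-cohomological
  obstruction criterion `H⁰(Z, 𝒪_V^Z)`; Peter–Weyl; Leray for partially stable orbits): NOT typed
  (no tree notion of the inverse-image sheaf); CHECK-t01.md rows.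
* **§6 Props. 6.1, 6.2** (generic circuit polynomial `H(Y)`, "`l = O(r²)`"): NOT typed (implicit
  constant; the generic-circuit form is only used by the §7 conjectures); rows.
* **§7**: the form `E(X) = ∏_σ det_σ(X)` DEFINED (`msE`); **Thm. 7.3** (its stability, char ∤ `k`,
  `k − 1`, `m`) named fact `MS2001_thm_7_3`; **Prop. 7.2** (first assertion: forms stabilized by
  `stab E(X)` are polynomials in the maximal minors — first fundamental theorem for `SL_m`,
  De Concini–Procesi in arbitrary characteristic) named fact `MS2001_prop_7_2`; Prop. 7.1 (identity
  component of the stabilizer), Thm. 7.4 (partial stability), Props. 7.7/7.9 and the CONJECTURES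
  7.5, 7.6, 7.8, 7.10, 7.11 are NOT typed (conjectures are not Literature; they need the untyped
  `H(Y)`); rows.

## Rendering notes

* MS work in `P(V)`, `V = Sym^m(Y)`, `G = SL(Y)`; a nonzero form's class lies in the projective
  closure of `G·[g]` iff the form lies in the affine cone `\overline{GL·g}` (MS §5, AV p.19 L2–3:
  "Here `f` lies in the closure of the `G`-orbit of `g` in `P(V)` iff it lies, considered as a point
  in `V`, [in] the closure of the `GL(Y)`-orbit of `g` in `V`"), which is the tree's `orbitClosure g`
  (`OrbitClosure.lean`; same rendering as `GCT.lean`'s design note). "Stable" in MS §3.1 (AV p.7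
  L24–27: "`y` is `G`-stable … iff the orbit `G.x` is (Zariski) closed") is the tree's `IsPolystable`
  (`Polystability.lean`, closed `SL`-orbit); the stabilizers `H`, `Q`, `R`, `K` of affine points in
  `G = SL` are `slSubgroup ⊓ linStabilizer`, as inside `fixedForms (slSubgroup σ F) f r` = `W^H` for
  `W = Sym^r` (`CharacterizedByStabilizer.lean`).
* Letters: MS's `Y` is `m × m` (determinant side), `X` is `n × n` or `k × k` (permanent side); the
  tree writes `paddedPerPoly k n m` with `(n, m)` = (permanent size, determinant size).
* No `instance`, no `notation`, no attribute changes (TYPER LINT RULE). Facts are `def … : Prop`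
  (D-0014), marked `-- FACT`; everything else is proved.

## References

* [MulmuleySohoniSIAM2001] K. D. Mulmuley, M. Sohoni, *Geometric complexity theory I: an approach to
  the P vs. NP and related problems*, SIAM J. Comput. 31 (2001) 496–526; authors' version of
  2001-04-23 (text of record, see above).
* [Regan2002] K. W. Regan, *Understanding the Mulmuley–Sohoni approach to P vs. NP*, Bull. EATCS 78
  (2002) 86–99 (numbering cross-check; held `paper:url-d5be32b36dcc`).
* [MulmuleySohoniGCT2SIAM2008] K. D. Mulmuley, M. Sohoni, *Geometric complexity theory II*, SIAM J.
  Comput. 38 (2008) 1175–1206, §1 (definition of "characterized by its stabilizer"), Thm. 2.3.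
* [BurgisserIkenmeyer2017] P. Bürgisser, C. Ikenmeyer, *Fundamental invariants of orbit closures*,
  J. Algebra 477 (2017), Cor. 2.9 (polystability of `det_n`, `per_n` over `ℂ`).
* [BurgisserClausenShokrollahi1997] P. Bürgisser, M. Clausen, M. A. Shokrollahi, *Algebraic
  Complexity Theory*, Thm. (21.27) (universality of the determinant with the size bound).
-/

noncomputable section

open MvPolynomial

namespace Literature.Computability.AlgebraicComplexity

/-! ## One-parameter families: `lim_{t → 0}` of orbit points lies in the Zariski closure

MS use degenerations `lim_{t→0} σ(t)·g` throughout §4 (AV p.17 L1161–1166, p.18: "`h(Y) =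
lim_{t→0} det(τ(t)M)` … belongs to the projective closure `Δ[det(Y)]`"). The algebraic form over any
infinite field: a family `F ∈ k[T][X]` whose specializations `F(t)`, `t ≠ 0`, lie in a set `S` has
`F(0)` in the Zariski closure of `S` (test polynomials pull back to polynomials in `T` vanishing on
`k ∖ {0}`). -/

section Family

variable {k : Type*} [Field k] {σ : Type*}

/-- **Specialization at `T = 0` of a one-parameter polynomial family lands in the Zariski closure**:
if `F ∈ k[T][X_σ]` has `F(t) ∈ S` for every `t ≠ 0` of the infinite field `k`, then the coefficient
vector of `F(0)` lies in the Zariski closure of the coefficient vectors of `S`. (For a test polynomial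
`p` vanishing on `S`, `t ↦ p(coeff F(t))` is a polynomial in `t` with infinitely many roots.)
This is the algebraic form, over any infinite field, of the limit device of Mulmuley–Sohoni 2001
§4.2 (AV p.17 L1161–1166, p.18: "`h(Y) = lim_{t→0} det(τ(t)M)` … In other words, `h(Y)` belongs to
the projective closure `Δ[det(Y)]`"). [cite: MulmuleySohoniSIAM2001, §4.2 (AV p.17–18, all.txt L1161–L1262: limits `lim_{t→0}` of orbit points lie in `Δ[g]`)] -/
theorem coeffVec_map_eval_zero_mem_zariskiClosure_of_family [Infinite k]
    (S : Set (MvPolynomial σ k)) (F : MvPolynomial σ (Polynomial k))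
    (hF : ∀ t : k, t ≠ 0 → MvPolynomial.map (Polynomial.evalRingHom t) F ∈ S) :
    coeffVec (MvPolynomial.map (Polynomial.evalRingHom 0) F) ∈ zariskiClosure (coeffVec '' S) := by
  rw [mem_zariskiClosure_iff]
  intro p hp
  -- the pulled-back test polynomial, a polynomial in `T`
  set R : Polynomial k := aeval (fun d : σ →₀ ℕ => coeff d F) p with hR
  have hkey : ∀ t : k,
      Polynomial.eval t R = aeval (coeffVec (MvPolynomial.map (Polynomial.evalRingHom t) F)) p := by
    intro t
    have h1 : Polynomial.eval t R = (Polynomial.aeval t : Polynomial k →ₐ[k] k) R := by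
      rw [Polynomial.coe_aeval_eq_eval]
    rw [h1, hR, ← AlgHom.comp_apply, MvPolynomial.comp_aeval]
    congr 1
  have hroots : ∀ t : k, t ≠ 0 → R.IsRoot t := by
    intro t ht
    rw [Polynomial.IsRoot, hkey t]
    exact hp _ (Set.mem_image_of_mem _ (hF t ht))
  have hinf : Set.Infinite {t : k | R.IsRoot t} := by
    refine ((Set.finite_singleton (0 : k)).infinite_compl).mono ?_
    intro t ht
    exact hroots t (by simpa using ht)
  have hR0 : R = 0 := Polynomial.eq_zero_of_infinite_isRoot R hinf
  have h0 := hkey 0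
  rw [hR0, Polynomial.eval_zero] at h0
  exact h0.symm

variable [Fintype σ] [DecidableEq σ]

/-- **`lim_{t→0}` of `GL`-orbit points lies in the orbit closure `Δ[f]`** (algebraic form, any
infinite field): if `F(t) ∈ GL · f` for all `t ≠ 0` then `F(0) ∈ \overline{GL · f}`.
Mulmuley–Sohoni 2001 §4.2 (AV p.18: "`h(Y) = lim_{t→0} det(τ(t)M)` … `h(Y)` belongs to the
projective closure `Δ[det(Y)]`"). [cite: MulmuleySohoniSIAM2001, §4.2 (AV p.18, all.txt L1248–L1262: `lim_{t→0}` of orbit points lies in `Δ[g]`)] -/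
theorem map_eval_zero_mem_orbitClosure_of_family [Infinite k] {f : MvPolynomial σ k}
    (F : MvPolynomial σ (Polynomial k))
    (hF : ∀ t : k, t ≠ 0 → MvPolynomial.map (Polynomial.evalRingHom t) F ∈ glOrbit σ k f) :
    MvPolynomial.map (Polynomial.evalRingHom 0) F ∈ orbitClosure f :=
  coeffVec_map_eval_zero_mem_zariskiClosure_of_family (glOrbit σ k f) F hF

end Family

/-! ## §4 Formula size (AV pp. 11–18) -/

section FormulaSize

variable {k : Type*} [Field k]

/-- **GCT I, Prop. 4.1** (AV p.12, all.txt L756–758): "If `f(X)` has a formula of size `l` then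
`f^φ(Y)` lies in the projective orbit closure `Δ[det(Y)]` of the determinant, where
`m = dim(Y) = 2l`." Here `f^φ(Y) = y^{m-d} f(φ(X))` for a form `f` of degree `d`, any placement `ι`
of the variables of `f` among the entries of the `m × m` matrix `Y` and any entry `y` (the print
takes `φ(X)` a submatrix and `y` outside it; the statement holds for every `ι`, `y`). PROVED from the
tree: a formula (expression `φ`, size `u = E(φ)`, BCS (21.19)) gives a projection of `DET_{2u+2}`
(`ArithExpr.isDetProjection_eval`, BCS Thm. (21.27) = Valiant 1979), hence an affine determinantal
representation of every size `m ≥ 2u + 2` (`IsDetProjection.hasDetRepr_holds`, `HasDetRepr.mono_holds`),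
whose homogenisation lies in `End · det_m ⊆ Δ[det_m]` (`X_pow_mul_rename_mem_endOrbit_detPoly`,
`endOrbit_subset_orbitClosure_holds` — the density of `GL_{m²}` in all matrices, eq. (3) of the
printed proof). CONSTANT: as printed `m = 2l` (Valiant's [45] construction and MS's size count);
typed with the tree's universality constant `m ≥ 2u + 2`. Over any infinite field (print: `F`
algebraically closed). [cite: MulmuleySohoniSIAM2001, Prop. 4.1 (AV p.12, all.txt L756)] -/
theorem MS2001_prop_4_1 [Infinite k] {τ : Type*} [Fintype τ] [DecidableEq τ]
    (φ : ArithExpr k τ) {d m : ℕ} (hφ : φ.eval.IsHomogeneous d) (hdm : d ≤ m)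
    (hm : 2 * φ.size + 2 ≤ m) (ι : τ → Fin m × Fin m) (y : Fin m × Fin m) :
    X y ^ (m - d) * rename ι φ.eval ∈ orbitClosure (detPoly (Fin m) k) := by
  have hrepr : HasDetRepr φ.eval m :=
    HasDetRepr.mono_holds (IsDetProjection.hasDetRepr_holds φ.isDetProjection_eval) hm
  exact endOrbit_subset_orbitClosure_holds _
    (X_pow_mul_rename_mem_endOrbit_detPoly hφ hdm hrepr ι y)

-- FACT (R2: the char-`p` torus-weight argument is not in the tree; char 0 proved below)
/-- **GCT I, Prop. 4.2** (AV p.13, all.txt L827): "Every form `h(Y) ∈ V` stabilized by `R` is a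
multiple of `det(Y)`" — `V` = forms of degree `m` in the entries of the `m × m` matrix `Y`,
`R` = the stabilizer of `det(Y)` in `G = SL_{m²}(F)` (eq. (4): `Y ↦ A Y^* B^{-1}`), `F` an
algebraically closed field of ARBITRARY characteristic (§4, AV p.11). Typed in the authors' own
formalization of "characterized by its stabilizer" (GCT II §1, `V^{G_v̂} = ℂ v`; tree
`IsCharacterizedByStabilizerIn`, `G = slSubgroup`): every degree-`m` form fixed by every element
of `SL_{m²}(F)` fixing `det_m` is a scalar multiple of `det_m`. Characteristic `0`: PROVED
(`MS2001_prop_4_2_of_charZero`); positive characteristic: open in the tree.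
[cite: MulmuleySohoniSIAM2001, Prop. 4.2 (AV p.13, all.txt L827)]
[cite: MulmuleySohoniGCT2SIAM2008, §1 (definition of "characterized by its stabilizer")] -/
def MS2001_prop_4_2 : Prop :=
  ∀ (F : Type) [Field F] [IsAlgClosed F] (m : ℕ),
    IsCharacterizedByStabilizerIn (slSubgroup (Fin m × Fin m) F) (detPoly (Fin m) F) m

/-- **GCT I, Prop. 4.2 in characteristic zero, PROVED** for every field of characteristic `0`
(not only algebraically closed ones): restatement for `slSubgroup` of the tree's
`CharacterizedByStabilizer.detPoly_eq_smul_of_fixed_of_det_eq_one` (whose `ℂ`-instance is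
`isCharacterizedByStabilizerIn_slSubgroup_detPoly`).
[cite: MulmuleySohoniSIAM2001, Prop. 4.2 (AV p.13, all.txt L827)] -/
theorem MS2001_prop_4_2_of_charZero (F : Type*) [Field F] [CharZero F] (m : ℕ) :
    IsCharacterizedByStabilizerIn (slSubgroup (Fin m × Fin m) F) (detPoly (Fin m) F) m :=
  fun p hp hfix => CharacterizedByStabilizer.detPoly_eq_smul_of_fixed_of_det_eq_one p hp
    fun γ hdet hfixdet => hfix γ (mem_slSubgroup_iff.mpr hdet) hfixdet

-- FACT (R1: Kempf's criterion / Hilbert–Mumford in arbitrary characteristic; `ℂ` proved below)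
/-- **GCT I, Thm. 4.6** (AV p.15, all.txt L935–937): "The point `det(Y) ∈ P(V)` is stable with
respect to the action of `G = SL_{m²}(F)` on `P(V)`, where `V` is the space of homogeneous forms
of degree `m` in `Y`." Here `F` is an algebraically closed field of arbitrary characteristic (§4,
AV p.11) and "stable" is MS §3.1 (AV p.7): the orbit `G·x` of an affine representative is Zariski
closed — the tree's `IsPolystable` (closed `SL`-orbit). Printed proof: the stabilizer `R` is not
contained in any proper parabolic subgroup (its representation on `m × m` matrices, eq. (4), is
irreducible), so Kempf's criterion [23] applies. The case `F = ℂ` is PROVED in the tree: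
`(BurgisserIkenmeyer2017_polystable_det_per_holds m).1` (Bürgisser–Ikenmeyer 2017 Cor. 2.9,
`PolystabilityProofs.lean`), already aliased as `Bur24_thm_7_2` (`Bur24GCTOpenProblems.lean`) — CITED,
not restated. (Journal numbering, inferred — see the module docstring: Thm. 4.1, as cited by BLMW 2011 "[MS1],
Theorem 4.1".) [cite: MulmuleySohoniSIAM2001, Thm. 4.6 of the authors' version = journal Thm. 4.1 (AV p.15, all.txt L935)] -/
def MS2001_thm_4_6 : Prop :=
  ∀ (F : Type) [Field F] [IsAlgClosed F] (m : ℕ), IsPolystable (detPoly (Fin m) F)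

-- FACT (R1: Kempf's criterion / Hilbert–Mumford in arbitrary characteristic; `ℂ` proved below)
/-- **GCT I, Thm. 4.7** (AV p.15, all.txt L952–954): "The point `perm(X) ∈ P(W)`, where
`dim(X) = k`, is stable with respect to the action of `SL_n(F)` on `P(W)`, where `n = k²`." (`W` =
forms of degree `k` in the entries of the `k × k` matrix `X`; `F` algebraically closed of arbitrary
characteristic — the text assumes char `≠ 2` only to distinguish `perm` from `det`, AV p.14, and in
characteristic `2` the statement is Thm. 4.6.) "Stable" = closed `SL`-orbit = `IsPolystable`.
Printed proofs: Kempf's criterion (the stabilizer (5) acts irreducibly on `k × k` matrices), and a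
second proof by one-parameter subgroups commuting with the torus `K⁰` plus Hall's theorem
(AV pp.15–16). The case `F = ℂ` is PROVED in the tree (`MS2001_thm_4_7_complex`).
(Journal numbering, inferred: Thm. 4.2.)
[cite: MulmuleySohoniSIAM2001, Thm. 4.7 of the authors' version = journal Thm. 4.2 (AV p.15, all.txt L952)] -/
def MS2001_thm_4_7 : Prop :=
  ∀ (F : Type) [Field F] [IsAlgClosed F] (n : ℕ), IsPolystable (perPoly (Fin n) F)

/-- **GCT I, Thm. 4.7 over `ℂ`, PROVED**: `per_n` has a closed `SL_{n²}(ℂ)`-orbit — the `per` clause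
of Bürgisser–Ikenmeyer 2017 Cor. 2.9 (`BurgisserIkenmeyer2017_polystable_det_per_holds`).
[cite: MulmuleySohoniSIAM2001, Thm. 4.7 of the authors' version = journal Thm. 4.2 (AV p.15, all.txt L952)]
[cite: BurgisserIkenmeyer2017, Cor. 2.9] -/
theorem MS2001_thm_4_7_complex (n : ℕ) : IsPolystable (perPoly (Fin n) ℂ) :=
  (BurgisserIkenmeyer2017_polystable_det_per_holds n).2

end FormulaSize

/-! ## §4.2 Exterior limit points (AV pp. 16–18) -/

section LimitPoints

variable {k : Type*} [Field k] {σ : Type*} [Fintype σ] [DecidableEq σ]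

/-- **Interior limit point** of `Δ[g]` (GCT I §4.2, AV p.16 all.txt L1131 – p.17 L1153): "We call a
point in `Δ[g]` an interior limit point, if it is of the form `det(σY)`, for some possibly singular
linear transformation `σ`. In other words, the set of interior points is the image of the map
`α : M_{m²}(F) → Δ[g]`", stated in §4.2 for `g = det(Y)`; here for any `g`: `f` is a linear
substitution instance of `g`, i.e. `f ∈ End · g` (`endOrbit`). (Affine rendering of the projective
definition: over an algebraically closed field the cone `End · g` is closed under scalars.)
[cite: MulmuleySohoniSIAM2001, §4.2 (AV p.16–17, all.txt L1131–L1153)] -/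
def IsInteriorLimitPoint (g f : MvPolynomial σ k) : Prop :=
  f ∈ endOrbit σ k g

/-- **Exterior limit point** of `Δ[g]` (GCT I §4.2, AV p.17 all.txt L1153): "The points of `Δ[g]` not
in this image will be called exterior limit points": `f ∈ Δ[g] = \overline{GL · g}` but
`f ∉ End · g`. [cite: MulmuleySohoniSIAM2001, §4.2 (AV p.17, all.txt L1153)] -/
def IsExteriorLimitPoint (g f : MvPolynomial σ k) : Prop :=
  f ∈ orbitClosure g ∧ f ∉ endOrbit σ k g

omit [Fintype σ] [DecidableEq σ] in
/-- Unfolding of `IsInteriorLimitPoint`. [cite: MulmuleySohoniSIAM2001, §4.2 (AV p.16–17)] -/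
theorem isInteriorLimitPoint_iff {g f : MvPolynomial σ k} [Fintype σ] :
    IsInteriorLimitPoint g f ↔ ∃ A : Matrix σ σ k, linSubst σ k A g = f :=
  Iff.rfl

/-- Interior limit points are points of `Δ[g]` ("the image of the map `α : M_{m²}(F) → Δ[g]`",
AV p.17 L1134–1136): `End · g ⊆ \overline{GL · g}` over an infinite field, by the density of `GL` in
all matrices (`endOrbit_subset_orbitClosure_holds`).
[cite: MulmuleySohoniSIAM2001, §4.2 (AV p.17, all.txt L1134)] -/
theorem IsInteriorLimitPoint.mem_orbitClosure [Infinite k] {g f : MvPolynomial σ k}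
    (h : IsInteriorLimitPoint g f) : f ∈ orbitClosure g :=
  endOrbit_subset_orbitClosure_holds _ h

/-- The printed dichotomy of `Δ[g]` into interior and exterior limit points (AV p.17 L1153), over an
infinite field. [cite: MulmuleySohoniSIAM2001, §4.2 (AV p.17, all.txt L1153)] -/
theorem mem_orbitClosure_iff_isInteriorLimitPoint_or_isExteriorLimitPoint [Infinite k]
    {g f : MvPolynomial σ k} :
    f ∈ orbitClosure g ↔ IsInteriorLimitPoint g f ∨ IsExteriorLimitPoint g f := by
  constructor
  · intro h
    by_cases hi : f ∈ endOrbit σ k g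
    · exact Or.inl hi
    · exact Or.inr ⟨h, hi⟩
  · rintro (h | h)
    · exact h.mem_orbitClosure
    · exact h.1

/-- An exterior limit point is not an interior one (definitional bookkeeping).
[cite: MulmuleySohoniSIAM2001, §4.2 (AV p.17, all.txt L1153)] -/
theorem IsExteriorLimitPoint.not_isInteriorLimitPoint {g f : MvPolynomial σ k}
    (h : IsExteriorLimitPoint g f) : ¬ IsInteriorLimitPoint g f :=
  h.2

/-- **"Interior limit points have formulae of quasi-polynomial size"** (AV p.17 L1153–1155, via the
proof of Prop. 4.4: an interior limit point `det(σY)` is `det(W)` for a matrix `W` of linear forms),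
in determinantal-complexity form: an interior limit point of `Δ[det_m]` has an affine (indeed linear)
determinantal representation of size `m`, i.e. `dc ≤ m` (whence formula size `m^{O(log m)}` by
[2] Berkowitz, not restated). [cite: MulmuleySohoniSIAM2001, §4.2 (AV p.17, all.txt L1153–L1155)] -/
theorem IsInteriorLimitPoint.hasDetRepr {m : ℕ} {f : MvPolynomial (Fin m × Fin m) k}
    (h : IsInteriorLimitPoint (detPoly (Fin m) k) f) : HasDetRepr f m := by
  obtain ⟨A, rfl⟩ := h
  refine ⟨(Matrix.mvPolynomialX (Fin m) (Fin m) k).map (linSubst _ k A), ?_, ?_⟩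
  · intro i j
    rw [Matrix.map_apply, Matrix.mvPolynomialX_apply]
    exact (linSubst_isHomogeneous A (isHomogeneous_X k (i, j))).totalDegree_le
  · change _ = linSubst _ k A (detPoly (Fin m) k)
    rw [detPoly, AlgHom.map_det, AlgHom.mapMatrix_apply]

end LimitPoints

/-! ## §5 Explicit obstructions (AV pp. 18–27) -/

section Obstructions

-- FACT (R1: Luna's étale slice theorem)
-- TODO(general form): MS state Thm. 5.1 for an arbitrary finite-dimensional rational `G`-module `W`;
-- typed below for the modules `W = Sym^r` of forms of degree `r` (the case of Ex. 5.2.1).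
/-- **GCT I, Thm. 5.1 (characteristic zero)** (AV p.20, all.txt L1365–1372): "Let `H ⊆ G` be the
stabilizer of `f ∈ V`, and `Q ⊆ G` the stabilizer of `g ∈ V`. Suppose `f` is stable with respect to
the action of `G`. Then a (nonzero) representation `W` of `G` is an obstruction for the pair `(f, g)`
if `W` contains a trivial `H`-submodule but not a trivial `Q`-submodule. In other words, if such a
`W` exists then `f` cannot lie in the closure of the `G`-orbit of `g` in the projective space `P(V)`.
More generally, `W` is an obstruction for `(f, g)` if the multiplicity of the trivial
`H`-representation within `W` exceeds that of the trivial `Q`-representation." Setting (§5, AV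
p.18–19): `V` a representation of the reductive `G`, here (as in Conj. 4.3 and Ex. 5.2.1) `V` = forms
of degree `m` in variables `σ`, `G = SL_σ(F)`, `F` algebraically closed of characteristic `0`
(the theorem's standing hypothesis). Typed for the concrete representations `W = Sym^r` = forms of
degree `r` under linear substitution, where "multiplicity of the trivial `H`-representation" =
`dim W^H` = `finrank (fixedForms (slSubgroup σ F) f r)` (`H = SL ∩ Stab f`); "stable" =
`IsPolystable` (MS §3.1); conclusion in the affine-cone rendering `f ∉ \overline{GL · g}`
(module docstring). `TODO(general form)`: arbitrary finite-dimensional rational `G`-modules `W`.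
Printed proof: Luna's slice theorem (stabilizers near the closed orbit `Gf` are conjugate into `H`),
second proof by Peter–Weyl. (Journal numbering: Thm. 5.1, as cited by Regan 2002.)
[cite: MulmuleySohoniSIAM2001, Thm. 5.1 (AV p.20, all.txt L1365; journal Thm. 5.1)] -/
def MS2001_thm_5_1 : Prop :=
  ∀ (F : Type) [Field F] [IsAlgClosed F] [CharZero F] (σ : Type) [Fintype σ] [DecidableEq σ]
    (f g : MvPolynomial σ F) (m : ℕ), f.IsHomogeneous m → g.IsHomogeneous m → IsPolystable f →
    (∃ r : ℕ, Module.finrank F (fixedForms (slSubgroup σ F) g r) <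
      Module.finrank F (fixedForms (slSubgroup σ F) f r)) →
    f ∉ orbitClosure g

/-- **GCT I, §5.3.1 "Example 2"** (AV p.23, all.txt L1622–1647; [38] Popov–Vinberg): "Let `V` be the
space of forms of total degree `3` in variables `x` and `y`, and `G = SL₂`. Let `f = x²y`, and
`g = x³ + y³`. Then it is easy to show that `f` lies in the projective closure `Δ[g]` of the
`G`-orbit of `g` in `P(V)`" — PROVED, over every algebraically closed field of characteristic `0`
(print: `ℂ`), in the affine-cone rendering `x²y ∈ \overline{GL₂ · (x³ + y³)}`: the degeneration
`x²y + t·xy² + (t²/3)·y³ = g(r(x + ty), −rx)`, `r³ = 1/(3t)`, at `t = 0`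
(`map_eval_zero_mem_orbitClosure_of_family`). (The rest of Example 2 — `f` is not stable, `H`
trivial, `Q = {diag(ε, ε⁻¹) | ε³ = 1}` — is not restated.)
[cite: MulmuleySohoniSIAM2001, §5.3.1 Example 2 (AV p.23, all.txt L1622)] -/
theorem MS2001_example_5_3_1 {k : Type*} [Field k] [IsAlgClosed k] [CharZero k] :
    (X 0 ^ 2 * X 1 : MvPolynomial (Fin 2) k) ∈
      orbitClosure (X 0 ^ 3 + X 1 ^ 3 : MvPolynomial (Fin 2) k) := by
  haveI : Infinite k := IsAlgClosed.instInfinite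
  -- the family `x²y + T xy² + (T²/3) y³`
  set F : MvPolynomial (Fin 2) (Polynomial k) :=
    X 0 ^ 2 * X 1 + C Polynomial.X * (X 0 * X 1 ^ 2) +
      C (Polynomial.C (3⁻¹ : k) * Polynomial.X ^ 2) * X 1 ^ 3 with hF
  have hF0 : MvPolynomial.map (Polynomial.evalRingHom (0 : k)) F = X 0 ^ 2 * X 1 := by
    simp [hF, map_X]
  rw [← hF0]
  refine map_eval_zero_mem_orbitClosure_of_family F fun t ht => ?_
  have hFt : MvPolynomial.map (Polynomial.evalRingHom t) F =
      X 0 ^ 2 * X 1 + C t * (X 0 * X 1 ^ 2) + C (3⁻¹ * t ^ 2) * X 1 ^ 3 := by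
    simp [hF, map_X]
  rw [hFt]
  -- a cube root `r` of `1/(3t)`
  have h3t : (3 : k) * t ≠ 0 := mul_ne_zero three_ne_zero ht
  obtain ⟨r, hr⟩ := IsAlgClosed.exists_pow_nat_eq ((3 * t)⁻¹ : k) (by norm_num : 0 < 3)
  have hr0 : r ≠ 0 := by
    rintro rfl
    rw [zero_pow (by norm_num)] at hr
    exact (inv_ne_zero h3t) hr.symm
  -- the substitution `x ↦ r(x + t y)`-row data: `B j i` is the coefficient of `X j` in the image of `X i`
  set B : Matrix (Fin 2) (Fin 2) k := !![r, -r; r * t, 0] with hB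
  have hBdet : B.det ≠ 0 := by
    rw [hB, Matrix.det_fin_two_of]
    have : r * 0 - -r * (r * t) = r ^ 2 * t := by ring
    rw [this]
    exact mul_ne_zero (pow_ne_zero _ hr0) ht
  refine ⟨Matrix.GeneralLinearGroup.mkOfDetNeZero B hBdet, ?_⟩
  change linSubst (Fin 2) k B (X 0 ^ 3 + X 1 ^ 3) = _
  have hX0 : linSubst (Fin 2) k B (X 0) = C r * X 0 + C (r * t) * X 1 := by
    rw [linSubst_X, Fin.sum_univ_two]
    simp [hB, smul_eq_C_mul]
  have hX1 : linSubst (Fin 2) k B (X 1) = -(C r * X 0) := by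
    rw [linSubst_X, Fin.sum_univ_two]
    simp [hB, smul_eq_C_mul]
  rw [map_add, map_pow, map_pow, hX0, hX1]
  -- the scalar identities, transported into the polynomial ring
  have h1 : (C r : MvPolynomial (Fin 2) k) ^ 3 * (3 * C t) = 1 := by
    have hk : r ^ 3 * (3 * t) = 1 := by rw [hr, inv_mul_cancel₀ h3t]
    have := congrArg (C : k →+* MvPolynomial (Fin 2) k) hk
    simpa [map_mul, map_pow, map_ofNat] using this
  have h2 : (3 : MvPolynomial (Fin 2) k) * C (3⁻¹ : k) = 1 := by
    rw [← map_ofNat (C : k →+* MvPolynomial (Fin 2) k) 3, ← map_mul,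
      mul_inv_cancel₀ (three_ne_zero : (3 : k) ≠ 0), map_one]
  have hsplit : (C (3⁻¹ * t ^ 2) : MvPolynomial (Fin 2) k) = C (3⁻¹ : k) * C t ^ 2 := by
    rw [map_mul, map_pow]
  rw [map_mul C r t, hsplit]
  linear_combination (X 0 ^ 2 * X 1 + C t * (X 0 * X 1 ^ 2) + C (3⁻¹ : k) * C t ^ 2 * X 1 ^ 3) * h1
    - (C r ^ 3 * C t ^ 3 * X 1 ^ 3) * h2

/-- Evaluation rule for linear substitution: `(A · f)(x) = f(Aᵀ x)`. [folklore] -/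
private theorem eval_linSubst' {k : Type*} [Field k] {σ : Type*} [Fintype σ] (A : Matrix σ σ k)
    (f : MvPolynomial σ k) (x : σ → k) :
    MvPolynomial.eval x (linSubst σ k A f) = MvPolynomial.eval (A.transpose.mulVec x) f := by
  have h : (MvPolynomial.eval x).comp (linSubst σ k A : MvPolynomial σ k →+* MvPolynomial σ k) =
      MvPolynomial.eval (A.transpose.mulVec x) := by
    refine MvPolynomial.ringHom_ext (fun c => ?_) (fun i => ?_)
    · rw [RingHom.comp_apply, RingHom.coe_coe, linSubst_C, eval_C, eval_C]
    · rw [RingHom.comp_apply, RingHom.coe_coe, linSubst_X, eval_X, map_sum, Matrix.mulVec,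
        dotProduct]
      exact Finset.sum_congr rfl fun j _ => by
        rw [smul_eval, eval_X, Matrix.transpose_apply]
  exact RingHom.congr_fun h f

/-- **Exterior limit points exist (illustration, ours, of Def. §4.2 on the forms of Ex. 5.3.1).**
`x²y` is an EXTERIOR limit point of `Δ[x³ + y³]`: it lies in the orbit closure
(`MS2001_example_5_3_1`) but is no linear-substitution instance `(ax+by)³ + (cx+dy)³` of `x³ + y³`
— comparing values at `(1,0), (0,1), (1,1), (1,-1)` gives `a³+c³ = b³+d³ = ab²+cd² = 0` and
`3(a²b+c²d) = 1`, while `(a²b+c²d)³` lies in the ideal `(a³+c³, b³+d³, ab²+cd²)` (explicit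
certificate). MS (§4.2, AV p.17 L1155–1159) note that for `Δ[det(Y)]` "formally proving that a given
point is an exterior limit point … is a lower bound problem in itself"; for the binary cubic it is
this elementary computation. Any algebraically closed field of characteristic `0`.
[cite: MulmuleySohoniSIAM2001, §4.2 (exterior limit points, AV p.17 all.txt L1153) applied to §5.3.1 Example 2 (AV p.23)] -/
theorem MS2001_example_5_3_1_isExteriorLimitPoint {k : Type*} [Field k] [IsAlgClosed k] [CharZero k] :
    IsExteriorLimitPoint (X 0 ^ 3 + X 1 ^ 3 : MvPolynomial (Fin 2) k) (X 0 ^ 2 * X 1) := by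
  refine ⟨MS2001_example_5_3_1, ?_⟩
  rintro ⟨A, hA⟩
  have hev : ∀ x y : k,
      (A 0 0 * x + A 1 0 * y) ^ 3 + (A 0 1 * x + A 1 1 * y) ^ 3 = x ^ 2 * y := by
    intro x y
    have h := congrArg (MvPolynomial.eval ![x, y]) hA
    rw [eval_linSubst'] at h
    simp only [map_add, map_pow, map_mul, eval_X, Matrix.mulVec, dotProduct, Fin.sum_univ_two,
      Matrix.transpose_apply, Matrix.cons_val_zero, Matrix.cons_val_one] at h
    linear_combination h
  set a := A 0 0
  set b := A 1 0
  set c := A 0 1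
  set d := A 1 1
  have hP : a ^ 3 + c ^ 3 = 0 := by linear_combination hev 1 0
  have hR : b ^ 3 + d ^ 3 = 0 := by linear_combination hev 0 1
  have h11 := hev 1 1
  have h1m := hev 1 (-1)
  have hT6 : (6 : k) * (a * b ^ 2 + c * d ^ 2) = 0 := by
    linear_combination h11 + h1m - 2 * hP
  have hT : a * b ^ 2 + c * d ^ 2 = 0 :=
    (mul_eq_zero.mp hT6).resolve_left (by norm_num)
  have hS2 : (2 : k) * (3 * (a ^ 2 * b + c ^ 2 * d)) = 2 * 1 := by
    linear_combination h11 - h1m - 2 * hR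
  have hS : 3 * (a ^ 2 * b + c ^ 2 * d) = 1 := mul_left_cancel₀ two_ne_zero hS2
  -- the Nullstellensatz certificate: `S³ ∈ (P, R, T)`
  have key : (3 * (a ^ 2 * b + c ^ 2 * d)) ^ 3 =
      27 * ((a ^ 3 * b ^ 3 + 3 * a * b ^ 2 * c ^ 2 * d - 4 * b ^ 3 * c ^ 3) * (a ^ 3 + c ^ 3) +
        4 * c ^ 6 * (b ^ 3 + d ^ 3) +
        (3 * a ^ 2 * b * c ^ 3 - 3 * c ^ 5 * d) * (a * b ^ 2 + c * d ^ 2)) := by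
    ring
  rw [hS, hP, hR, hT] at key
  norm_num at key

end Obstructions

/-! ## §7 P vs. NP: the form `E(X)` (AV pp. 29–34) -/

section PvsNP

variable (F : Type*) [CommRing F]

/-- **The form `E(X)` of GCT I §7** (AV p.30): for the `m × km` variable matrix `X` with column
vectors `X^j_i ∈ F^m` (`1 ≤ i ≤ m`, `1 ≤ j ≤ k`), "for any function `σ : {1,…,m} → {1,…,k}`, let
`det_σ(X)` denote the determinant of the matrix whose `i`-th column is `X^{σ(i)}_i`. Define
`E(X) = ∏_σ det_σ(X)` where `σ` ranges over all such functions. This is well defined over any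
field." (It is the resultant-type form of the system (11) of `m` products of `k` linear forms in
`m` unknowns: the system has a nonzero solution over `F_p` iff `E(X) = 0`.) Variables are indexed
by (row `r`, (column group `i`, index `j`)); `n = km²` entries in all.
[cite: MulmuleySohoniSIAM2001, §7 (definition of `E(X)`, AV p.30)] -/
def msE (m kk : ℕ) : MvPolynomial (Fin m × (Fin m × Fin kk)) F :=
  ∏ σ : Fin m → Fin kk, (Matrix.of fun r i : Fin m => (X (r, (i, σ i)) : MvPolynomial _ F)).det

/-- The maximal minors (Plücker coordinates) of the `m × km` variable matrix `X` of §7: the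
determinants of the `m × m` matrices of columns `e 0, …, e (m-1)` (zero when `e` is not injective).
[cite: MulmuleySohoniSIAM2001, §7 (Prop. 7.2, "maximal minors of `X`", AV p.31)] -/
def msMaximalMinor (m kk : ℕ) (e : Fin m → Fin m × Fin kk) :
    MvPolynomial (Fin m × (Fin m × Fin kk)) F :=
  (Matrix.of fun r c : Fin m => (X (r, e c) : MvPolynomial _ F)).det

variable {F}

/-- `E(X)` is the product, over the column choices `σ`, of the maximal minors on the columns
`(i, σ i)` — "its expansion in terms of Plücker coordinates contains only one monomial" (Prop. 7.2,
second assertion, definitional form). [cite: MulmuleySohoniSIAM2001, Prop. 7.2 (AV p.31, all.txt L2331)] -/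
theorem msE_eq_prod_msMaximalMinor (m kk : ℕ) :
    msE F m kk = ∏ σ : Fin m → Fin kk, msMaximalMinor F m kk fun i => (i, σ i) :=
  rfl

end PvsNP

section PvsNPFacts

-- FACT (R1: Kempf/Hilbert–Mumford stability argument of §8)
/-- **GCT I, Thm. 7.3** (AV p.31, all.txt L2342–2347): "The point `E(X) ∈ P(W)` is stable with
respect to the action of `G = SL_n(F)` on `P(W)`. We assume that the characteristic does not divide
`k`, `k − 1`, or `m`." (`W` = forms in the `n = km²` entries of `X` of the degree of `E(X)`; `F`
algebraically closed; "stable" = closed `SL`-orbit = `IsPolystable`; proved in §8 of the paper by a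
Kempf one-parameter-subgroup argument.) The divisibility hypotheses are stated with `ringChar F`
(in characteristic `0` they read `k ≠ 0`, `k ≠ 1`, `m ≠ 0`).
(Journal numbering, inferred: Thm. 7.1.)
[cite: MulmuleySohoniSIAM2001, Thm. 7.3 of the authors' version = journal Thm. 7.1 (inferred) (AV p.31, all.txt L2342)] -/
def MS2001_thm_7_3 : Prop :=
  ∀ (F : Type) [Field F] [IsAlgClosed F] (m kk : ℕ),
    ¬ (ringChar F ∣ kk) → ¬ (ringChar F ∣ (kk - 1)) → ¬ (ringChar F ∣ m) →
    IsPolystable (msE F m kk)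

-- FACT (R1: first fundamental theorem for `SL_m` — De Concini–Procesi in arbitrary characteristic)
/-- **GCT I, Prop. 7.2, first assertion** (AV p.31, all.txt L2331–2334): with `d` the total degree
of `E(X)` and `[E(X)]` "the set of forms of degree `d` in the entries of `X` that are stabilized by
`K`" (`K = stab(E(X))` in `SL_n(F)`, `n = km²`): "Any form `h(X) ∈ [E(X)]` can be expressed as a
homogeneous polynomial in the maximal minors of `X` (which correspond to Plücker coordinates)."
(Printed proof: `h` is stabilized by `SL_m` acting on `X` by left multiplication, which lies in
`K`; classical invariant theory, in arbitrary characteristic De Concini–Procesi [8].) Here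
`d = m · k^m` and `[E(X)] = fixedForms (slSubgroup _ F) (msE F m k) d`.
[cite: MulmuleySohoniSIAM2001, Prop. 7.2 (AV p.31, all.txt L2331)] -/
def MS2001_prop_7_2 : Prop :=
  ∀ (F : Type) [Field F] [IsAlgClosed F] (m kk : ℕ),
    ∀ h ∈ fixedForms (slSubgroup (Fin m × (Fin m × Fin kk)) F) (msE F m kk) (m * kk ^ m),
      h ∈ Algebra.adjoin F (Set.range (msMaximalMinor F m kk))

end PvsNPFacts


/-! ## Discharge of `MS2001_prop_4_2` (GCT I Prop. 4.2 in arbitrary characteristic)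

The tree's `CharacterizedByStabilizer.detPoly_eq_smul_of_fixed_of_det_eq_one` proves the
characteristic-zero case with the torus weights `2^{[a=a₀]} 2^{-[b=b₀]}` (injectivity of `j ↦ 2^j`
through `CharZero`). The same elementary argument works over ANY infinite field once `2` is replaced
by an element `θ` that is not a root of unity of order `≤ n` (`exists_pow_ne_one`); the signed row
transpositions are characteristic-free. The private lemmas below transcribe the tree's proof with
this one change (they are private there, hence repeated); the public results are
`MS2001CharP.detPoly_eq_smul_of_fixed_of_det_eq_one_of_infinite` and the discharge
`MS2001_prop_4_2_holds`. -/

namespace MS2001CharP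

open Finset

variable {k : Type*} [Field k] {n : ℕ}


/-! ### Permutation exponents -/

/-- The exponent vector of the permutation monomial `∏ i, X (π i, i)`. [folklore] -/
private def permExp (π : Equiv.Perm (Fin n)) : (Fin n × Fin n) →₀ ℕ :=
  ∑ i, Finsupp.single (π i, i) 1

/-- Value of a permutation exponent at a variable index. [folklore] -/
private theorem permExp_apply (π : Equiv.Perm (Fin n)) (x : Fin n × Fin n) :
    permExp π x = if π x.2 = x.1 then 1 else 0 := by
  unfold permExp
  rw [Finsupp.finsetSum_apply]
  simp only [Finsupp.single_apply]
  rcases x with ⟨a, b⟩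
  rw [Finset.sum_eq_single b]
  · simp only [Prod.mk.injEq, and_true]
  · intro i _ hib
    rw [if_neg]
    simp only [Prod.mk.injEq, not_and]
    exact fun _ => hib
  · intro h; exact absurd (Finset.mem_univ b) h

/-- Distinct permutations have distinct permutation monomials. [folklore] -/
private theorem permExp_injective : Function.Injective (permExp (n := n)) := by
  intro π π' h
  ext i
  have := congrArg (fun e => e (π i, i)) h
  simp only [permExp_apply, if_true] at this
  by_contra hne
  rw [if_neg (fun h' => hne (congrArg Fin.val h'.symm))] at this
  exact one_ne_zero this

/-- `∏ i, X (π i, i)` is the monomial with exponent `permExp π`. [folklore] -/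
private theorem prod_X_eq_monomial_permExp (π : Equiv.Perm (Fin n)) :
    (∏ i, X (π i, i) : MvPolynomial (Fin n × Fin n) k) = monomial (permExp π) 1 := by
  rw [permExp, monomial_sum_one]
  rfl

/-- The generic determinant as a signed sum of permutation monomials (Leibniz expansion). [folklore] -/
private theorem detPoly_eq_sum (n : ℕ) :
    detPoly (Fin n) k = ∑ π : Equiv.Perm (Fin n),
      ((Equiv.Perm.sign π : ℤ) : k) • monomial (permExp π) 1 := by
  unfold detPoly
  rw [Matrix.det_apply']
  refine Finset.sum_congr rfl fun π _ => ?_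
  rw [← prod_X_eq_monomial_permExp, Algebra.smul_def, algebraMap_eq]
  simp [Matrix.mvPolynomialX, map_intCast]


/-! ### Diagonal substitutions and coefficients -/

section Diagonal

variable {σ : Type*} [Fintype σ] [DecidableEq σ]

omit [DecidableEq σ] in
/-- A `Finsupp.prod` of powers over a finite type is the product over all indices. [folklore] -/
private theorem prod_pow_eq_finsuppProd (β : σ → k) (e : σ →₀ ℕ) :
    (e.prod fun x m => β x ^ m) = ∏ x, β x ^ e x :=
  Finsupp.prod_fintype _ _ fun _ => pow_zero _

/-- A diagonal substitution scales the coefficient of `X^e` by `∏ β_x^{e x}` (torus weights of monomials). [folklore] -/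
private theorem coeff_linSubst_diagonal (β : σ → k) (p : MvPolynomial σ k) (e : σ →₀ ℕ) :
    coeff e (linSubst σ k (Matrix.diagonal β) p) = (∏ x, β x ^ e x) * coeff e p := by
  conv_lhs => rw [p.as_sum, map_sum]
  simp only [linSubst_diagonal_monomial, prod_pow_eq_finsuppProd, coeff_sum, coeff_smul,
    coeff_monomial, smul_eq_mul, mul_ite, mul_zero]
  rw [Finset.sum_ite_eq']
  split_ifs with h
  · rfl
  · rw [MvPolynomial.notMem_support_iff.mp h, mul_zero]

/-- The diagonal matrix with nonzero entries `β` as an element of `GL`. [folklore] -/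
private def diagGL (β : σ → k) (hβ : ∀ x, β x ≠ 0) : GL σ k :=
  Matrix.GeneralLinearGroup.mkOfDetNeZero (Matrix.diagonal β)
    (by rw [Matrix.det_diagonal]; exact Finset.prod_ne_zero_iff.mpr fun x _ => hβ x)

/-- Underlying matrix of `diagGL`. [folklore] -/
@[simp] private theorem coe_diagGL (β : σ → k) (hβ : ∀ x, β x ≠ 0) :
    ((diagGL β hβ : GL σ k) : Matrix σ σ k) = Matrix.diagonal β :=
  Matrix.GeneralLinearGroup.val_mkOfDetNeZero _ _

/-- A permutation of the variables as an element of `GL`, acting by `rename θ`. [folklore] -/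
private def permGL (θ : Equiv.Perm σ) : GL σ k :=
  Matrix.GeneralLinearGroup.mkOfDetNeZero (θ⁻¹.permMatrix k) (by
    rw [Matrix.det_permutation]
    rcases Int.units_eq_one_or (Equiv.Perm.sign θ⁻¹) with h | h <;> simp [h])

/-- `permGL θ` acts by renaming the variables along `θ`. [folklore] -/
private theorem linSubstRep_permGL (θ : Equiv.Perm σ) (q : MvPolynomial σ k) :
    linSubstRep σ k (permGL θ) q = rename θ q := by
  rw [linSubstRep_apply, permGL, Matrix.GeneralLinearGroup.val_mkOfDetNeZero, linSubst_permMatrix,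
    Equiv.Perm.inv_def, Equiv.symm_symm]

/-- `diagGL β` acts by the diagonal substitution. [folklore] -/
private theorem linSubstRep_diagGL (β : σ → k) (hβ : ∀ x, β x ≠ 0) (q : MvPolynomial σ k) :
    linSubstRep σ k (diagGL β hβ) q = linSubst σ k (Matrix.diagonal β) q := by
  rw [linSubstRep_apply, coe_diagGL]

end Diagonal


/-! ### Row/column scalings fixing `per` and `det` -/

/-- Row sum `∑_b e(a,b)` of an exponent matrix. [folklore] -/
private def rowSum (e : (Fin n × Fin n) →₀ ℕ) (a : Fin n) : ℕ := ∑ b, e (a, b)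

/-- Column sum `∑_a e(a,b)` of an exponent matrix. [folklore] -/
private def colSum (e : (Fin n × Fin n) →₀ ℕ) (b : Fin n) : ℕ := ∑ a, e (a, b)

/-- The torus weight scaling row class `a` by `θ` and column class `b` by `θ⁻¹`. [folklore] -/
private def rcWeight (θ : k) (a b : Fin n) (x : Fin n × Fin n) : k :=
  (if x.1 = a then θ else 1) * (if x.2 = b then θ⁻¹ else 1)

/-- The row/column scaling weights are nonzero when `θ ≠ 0`. [folklore] -/
private theorem rcWeight_ne_zero {θ : k} (hθ : θ ≠ 0) (a b : Fin n) (x : Fin n × Fin n) :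
    rcWeight θ a b x ≠ 0 := by
  unfold rcWeight
  refine mul_ne_zero ?_ ?_ <;> split_ifs <;> simp [hθ]

/-- The character of the row/column scaling on `X^e` is `2^{rowSum e a} · 2^{-colSum e b}`. [folklore] -/
private theorem prod_rcWeight_pow (θ : k) (a b : Fin n) (e : (Fin n × Fin n) →₀ ℕ) :
    ∏ x, rcWeight θ a b x ^ e x = θ ^ rowSum e a * (θ⁻¹) ^ colSum e b := by
  simp only [rcWeight, mul_pow, Finset.prod_mul_distrib, ite_pow, one_pow]
  congr 1
  · rw [Fintype.prod_prod_type]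
    have h : ∀ x : Fin n, (∏ y : Fin n, if x = a then θ ^ e (x, y) else 1) =
        if x = a then θ ^ rowSum e x else 1 := fun x => by
      split_ifs <;> simp [rowSum, Finset.prod_pow_eq_pow_sum]
    simp_rw [h]
    rw [Finset.prod_ite_eq']
    simp
  · rw [Fintype.prod_prod_type_right]
    have h : ∀ y : Fin n, (∏ x : Fin n, if y = b then θ⁻¹ ^ e (x, y) else 1) =
        if y = b then θ⁻¹ ^ colSum e y else 1 := fun y => by
      split_ifs <;> simp [colSum, Finset.prod_pow_eq_pow_sum]
    simp_rw [h]
    rw [Finset.prod_ite_eq']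
    simp

/-- The character of a diagonal substitution on a permutation monomial. [folklore] -/
private theorem prod_pow_permExp (β : Fin n × Fin n → k) (π : Equiv.Perm (Fin n)) :
    ∏ x, β x ^ permExp π x = ∏ i, β (π i, i) := by
  simp only [permExp_apply, pow_ite, pow_one, pow_zero]
  rw [Fintype.prod_prod_type_right]
  refine Finset.prod_congr rfl fun b _ => ?_
  simp only []
  rw [Finset.prod_ite_eq]
  simp

/-- Permutation monomials are fixed by the row/column scalings. [folklore] -/
private theorem prod_rcWeight_permExp {θ : k} (hθ : θ ≠ 0) (a b : Fin n) (π : Equiv.Perm (Fin n)) :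
    ∏ i, rcWeight θ a b (π i, i) = 1 := by
  simp only [rcWeight, Finset.prod_mul_distrib]
  have h1 : ∏ i, (if π i = a then θ else 1) = θ := by
    simp_rw [show ∀ i, (π i = a ↔ i = π.symm a) from fun i => π.apply_eq_iff_eq_symm_apply (y := a)]
    rw [Finset.prod_ite_eq']; simp
  have h2 : ∏ i, (if i = b then θ⁻¹ else 1) = θ⁻¹ := by
    rw [Finset.prod_ite_eq']; simp
  rw [h1, h2]
  exact mul_inv_cancel₀ hθ

/-! ### Fixedness under the row/column scalings forces permutation-pattern support -/

section Support

variable {σ : Type*} [Fintype σ] [DecidableEq σ]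

/-- Diagonal substitution on a monomial, product over all indices. [folklore] -/
private theorem linSubst_diagonal_monomial' (β : σ → k) (e : σ →₀ ℕ) (c : k) :
    linSubst σ k (Matrix.diagonal β) (monomial e c) = (∏ x, β x ^ e x) • monomial e c := by
  rw [linSubst_diagonal_monomial, prod_pow_eq_finsuppProd]

/-- If a diagonal substitution fixes `p`, its character is `1` on every monomial of `p`. [folklore] -/
private theorem prod_pow_eq_one_of_fixed {β : σ → k} {p : MvPolynomial σ k}
    (hfix : linSubst σ k (Matrix.diagonal β) p = p) {e : σ →₀ ℕ} (he : e ∈ p.support) :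
    ∏ x, β x ^ e x = 1 := by
  have h := congrArg (coeff e) hfix
  rw [coeff_linSubst_diagonal] at h
  exact (mul_eq_right₀ (mem_support_iff.mp he)).mp h

end Support

/-- The row/column scalings fix every permutation monomial. [folklore] -/
private theorem linSubst_rcDiag_monomial_permExp {θ : k} (hθ : θ ≠ 0) (a b : Fin n)
    (π : Equiv.Perm (Fin n)) (c : k) :
    linSubst _ k (Matrix.diagonal (rcWeight θ a b)) (monomial (permExp π) c) =
      monomial (permExp π) c := by
  rw [linSubst_diagonal_monomial', prod_pow_permExp, prod_rcWeight_permExp hθ, one_smul]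

/-- The row/column scalings fix the determinant. [folklore] -/
private theorem linSubst_rcDiag_detPoly {θ : k} (hθ : θ ≠ 0) (a b : Fin n) :
    linSubst _ k (Matrix.diagonal (rcWeight θ a b)) (detPoly (Fin n) k) = detPoly (Fin n) k := by
  rw [detPoly_eq_sum, map_sum]
  simp_rw [map_smul, linSubst_rcDiag_monomial_permExp hθ]

/-- Powers of an element of multiplicative order `> n` separate exponents `≤ n`. [folklore] -/
private theorem eq_of_pow_eq {θ : k} (hθ : θ ≠ 0) (hθn : ∀ j, 0 < j → j ≤ n → θ ^ j ≠ 1)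
    {a b : ℕ} (ha : a ≤ n) (hb : b ≤ n) (h : θ ^ a = θ ^ b) : a = b := by
  by_contra hne
  rcases Nat.lt_or_gt_of_ne hne with hlt | hlt
  · have h2 : θ ^ a * θ ^ (b - a) = θ ^ a * 1 := by rw [← pow_add, Nat.add_sub_cancel' hlt.le, mul_one, h]
    exact hθn (b - a) (Nat.sub_pos_of_lt hlt) (le_trans (Nat.sub_le b a) hb)
      (mul_left_cancel₀ (pow_ne_zero a hθ) h2)
  · have h2 : θ ^ b * θ ^ (a - b) = θ ^ b * 1 := by rw [← pow_add, Nat.add_sub_cancel' hlt.le, mul_one, h]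
    exact hθn (a - b) (Nat.sub_pos_of_lt hlt) (le_trans (Nat.sub_le a b) ha)
      (mul_left_cancel₀ (pow_ne_zero b hθ) h2)

/-- A row sum of an exponent matrix is at most its degree. [folklore] -/
private theorem rowSum_le_degree (e : (Fin n × Fin n) →₀ ℕ) (a : Fin n) : rowSum e a ≤ e.degree := by
  rw [Finsupp.degree_eq_sum, Fintype.sum_prod_type]
  exact Finset.single_le_sum (f := fun a => ∑ b, e (a, b)) (fun _ _ => Nat.zero_le _) (Finset.mem_univ a)

/-- A column sum of an exponent matrix is at most its degree. [folklore] -/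
private theorem colSum_le_degree (e : (Fin n × Fin n) →₀ ℕ) (b : Fin n) : colSum e b ≤ e.degree := by
  rw [Finsupp.degree_eq_sum, Fintype.sum_prod_type_right]
  exact Finset.single_le_sum (f := fun b => ∑ a, e (a, b)) (fun _ _ => Nat.zero_le _) (Finset.mem_univ b)

/-- Fixedness under the `(a,b)` scaling forces `rowSum e a = colSum e b` on the support of a form
of degree `n`. [folklore] -/
private theorem rowSum_eq_colSum {θ : k} (hθ : θ ≠ 0) (hθn : ∀ j, 0 < j → j ≤ n → θ ^ j ≠ 1)
    {p : MvPolynomial (Fin n × Fin n) k} (hp : p.IsHomogeneous n) (a b : Fin n)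
    (hfix : linSubst _ k (Matrix.diagonal (rcWeight θ a b)) p = p) {e : (Fin n × Fin n) →₀ ℕ}
    (he : e ∈ p.support) : rowSum e a = colSum e b := by
  have h := prod_pow_eq_one_of_fixed hfix he
  rw [prod_rcWeight_pow, inv_pow, mul_inv_eq_one₀ (pow_ne_zero _ hθ)] at h
  have hdeg : e.degree = n := by
    by_contra hd
    exact (mem_support_iff.mp he) (hp.coeff_eq_zero hd)
  have ha : rowSum e a ≤ n := (rowSum_le_degree e a).trans_eq hdeg
  have hb : colSum e b ≤ n := (colSum_le_degree e b).trans_eq hdeg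
  exact eq_of_pow_eq hθ hθn ha hb h

/-- The degree of an exponent matrix is the sum of its row sums. [folklore] -/
private theorem degree_eq_sum_rowSum (e : (Fin n × Fin n) →₀ ℕ) : e.degree = ∑ a, rowSum e a := by
  rw [Finsupp.degree_eq_sum, Fintype.sum_prod_type]; rfl

/-- The degree of an exponent matrix is the sum of its column sums. [folklore] -/
private theorem degree_eq_sum_colSum (e : (Fin n × Fin n) →₀ ℕ) : e.degree = ∑ b, colSum e b := by
  rw [Finsupp.degree_eq_sum, Fintype.sum_prod_type_right]; rfl

/-- Monomials of a form of degree `n` have degree `n`. [folklore] -/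
private theorem degree_eq_of_mem_support {p : MvPolynomial (Fin n × Fin n) k} (hp : p.IsHomogeneous n)
    {e : (Fin n × Fin n) →₀ ℕ} (he : e ∈ p.support) : e.degree = n := by
  by_contra h
  exact (mem_support_iff.mp he) (hp.coeff_eq_zero h)

/-- All row sums of a monomial of a fixed form of degree `n` are `1`. [folklore] -/
private theorem rowSum_eq_one {θ : k} (hθ : θ ≠ 0) (hθn : ∀ j, 0 < j → j ≤ n → θ ^ j ≠ 1)
    {p : MvPolynomial (Fin n × Fin n) k} (hp : p.IsHomogeneous n)
    (hfix : ∀ a b : Fin n, linSubst _ k (Matrix.diagonal (rcWeight θ a b)) p = p)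
    {e : (Fin n × Fin n) →₀ ℕ} (he : e ∈ p.support) (a : Fin n) : rowSum e a = 1 := by
  have hcol : ∀ b, colSum e b = rowSum e a := fun b =>
    (rowSum_eq_colSum hθ hθn hp a b (hfix a b) he).symm
  have hsum : ∑ b : Fin n, colSum e b = n := by
    rw [← degree_eq_sum_colSum, degree_eq_of_mem_support hp he]
  simp only [hcol, Finset.sum_const, Finset.card_univ, Fintype.card_fin, smul_eq_mul] at hsum
  exact Nat.eq_of_mul_eq_mul_left (Fin.pos a) (by rw [mul_one]; exact hsum)

/-- All column sums of a monomial of a fixed form of degree `n` are `1`. [folklore] -/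
private theorem colSum_eq_one {θ : k} (hθ : θ ≠ 0) (hθn : ∀ j, 0 < j → j ≤ n → θ ^ j ≠ 1)
    {p : MvPolynomial (Fin n × Fin n) k} (hp : p.IsHomogeneous n)
    (hfix : ∀ a b : Fin n, linSubst _ k (Matrix.diagonal (rcWeight θ a b)) p = p)
    {e : (Fin n × Fin n) →₀ ℕ} (he : e ∈ p.support) (b : Fin n) : colSum e b = 1 := by
  have hrow : ∀ a, rowSum e a = colSum e b := fun a => rowSum_eq_colSum hθ hθn hp a b (hfix a b) he
  have hsum : ∑ a : Fin n, rowSum e a = n := by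
    rw [← degree_eq_sum_rowSum, degree_eq_of_mem_support hp he]
  simp only [hrow, Finset.sum_const, Finset.card_univ, Fintype.card_fin, smul_eq_mul] at hsum
  exact Nat.eq_of_mul_eq_mul_left (Fin.pos b) (by rw [mul_one]; exact hsum)

/-! ### Exponent matrices with unit row and column sums are permutation patterns -/

/-- A family of naturals summing to `1` is a single `1`. [folklore] -/
private theorem exists_eq_one_of_sum_eq_one {ι : Type*} [Fintype ι] [DecidableEq ι] (f : ι → ℕ)
    (h : ∑ i, f i = 1) : ∃ i, f i = 1 ∧ ∀ j, j ≠ i → f j = 0 := by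
  obtain ⟨i, -, hi⟩ := Finset.exists_ne_zero_of_sum_ne_zero (h.symm ▸ one_ne_zero : ∑ i, f i ≠ 0)
  have hsplit := Finset.add_sum_erase Finset.univ f (Finset.mem_univ i)
  rw [h] at hsplit
  have hfi : f i = 1 := by omega
  refine ⟨i, hfi, fun j hj => ?_⟩
  have hrest : ∑ x ∈ Finset.univ.erase i, f x = 0 := by omega
  exact Finset.sum_eq_zero_iff.mp hrest j (Finset.mem_erase.mpr ⟨hj, Finset.mem_univ j⟩)

/-- An exponent matrix with unit row and column sums is a permutation pattern. [folklore] -/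
private theorem exists_perm_eq_permExp {e : (Fin n × Fin n) →₀ ℕ} (hr : ∀ a, rowSum e a = 1)
    (hc : ∀ b, colSum e b = 1) : ∃ π : Equiv.Perm (Fin n), e = permExp π := by
  classical
  have hex : ∀ b : Fin n, ∃ a, e (a, b) = 1 ∧ ∀ a', a' ≠ a → e (a', b) = 0 :=
    fun b => exists_eq_one_of_sum_eq_one (fun a => e (a, b)) (hc b)
  choose g hg1 hg0 using hex
  have hinj : Function.Injective g := by
    intro b b' hbb'
    by_contra hne
    have h2 : ∑ x ∈ ({b, b'} : Finset (Fin n)), e (g b, x) ≤ rowSum e (g b) :=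
      Finset.sum_le_sum_of_subset_of_nonneg (Finset.subset_univ _) fun _ _ _ => Nat.zero_le _
    rw [Finset.sum_pair hne] at h2
    rw [hg1 b, hbb', hg1 b', ← hbb', hr] at h2
    omega
  refine ⟨Equiv.ofBijective g (Finite.injective_iff_bijective.mp hinj), ?_⟩
  ext ⟨a, b⟩
  rw [permExp_apply]
  simp only [Equiv.ofBijective_apply]
  split_ifs with h
  · rw [← h]; exact hg1 b
  · exact hg0 b a (Ne.symm h)

/-- Every monomial of a form of degree `n` fixed by the row/column scalings is a permutation monomial. [folklore] -/
private theorem exists_perm_of_mem_support {θ : k} (hθ : θ ≠ 0)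
    (hθn : ∀ j, 0 < j → j ≤ n → θ ^ j ≠ 1) {p : MvPolynomial (Fin n × Fin n) k}
    (hp : p.IsHomogeneous n)
    (hfix : ∀ a b : Fin n, linSubst _ k (Matrix.diagonal (rcWeight θ a b)) p = p)
    {e : (Fin n × Fin n) →₀ ℕ} (he : e ∈ p.support) : ∃ π : Equiv.Perm (Fin n), e = permExp π :=
  exists_perm_eq_permExp (rowSum_eq_one hθ hθn hp hfix he) (colSum_eq_one hθ hθn hp hfix he)

/-- A form supported on permutation patterns is the sum of its permutation monomials. [folklore] -/
private theorem eq_sum_monomial_permExp {p : MvPolynomial (Fin n × Fin n) k}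
    (hsupp : ∀ e ∈ p.support, ∃ π : Equiv.Perm (Fin n), e = permExp π) :
    p = ∑ π : Equiv.Perm (Fin n), monomial (permExp π) (coeff (permExp π) p) := by
  classical
  refine MvPolynomial.ext _ _ fun e => ?_
  rw [coeff_sum]
  simp only [coeff_monomial]
  by_cases he : ∃ π : Equiv.Perm (Fin n), e = permExp π
  · obtain ⟨π, rfl⟩ := he
    rw [Finset.sum_eq_single π]
    · rw [if_pos rfl]
    · intro π' _ hne
      rw [if_neg (fun h => hne (permExp_injective h))]
    · intro h; exact absurd (Finset.mem_univ π) h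
  · rw [Finset.sum_eq_zero (fun π _ => if_neg (fun h => he ⟨π, h.symm⟩))]
    by_contra hne
    exact he (hsupp e (mem_support_iff.mpr hne))


/-! ### Row permutations of the variables -/

/-- Row permutation of the variable indices: `(a, b) ↦ (τ a, b)`. [folklore] -/
private def rowPerm (τ : Equiv.Perm (Fin n)) : Equiv.Perm (Fin n × Fin n) :=
  Equiv.prodCongr τ (Equiv.refl _)

/-- Value of the row permutation of indices. [folklore] -/
@[simp] private theorem rowPerm_apply (τ : Equiv.Perm (Fin n)) (x : Fin n × Fin n) :
    rowPerm τ x = (τ x.1, x.2) := rfl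

/-- Row permutation of a permutation pattern: `permExp π ↦ permExp (τ π)`. [folklore] -/
private theorem mapDomain_rowPerm_permExp (τ π : Equiv.Perm (Fin n)) :
    Finsupp.mapDomain (rowPerm τ) (permExp π) = permExp (τ * π) := by
  unfold permExp
  rw [Finsupp.mapDomain_finsetSum]
  simp only [Finsupp.mapDomain_single, rowPerm_apply, Equiv.Perm.mul_apply]

/-- Row permutation of a permutation monomial. [folklore] -/
private theorem rename_rowPerm_monomial_permExp (τ π : Equiv.Perm (Fin n)) (c : k) :
    rename (rowPerm τ) (monomial (permExp π) c) = monomial (permExp (τ * π)) c := by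
  rw [rename_monomial, mapDomain_rowPerm_permExp]

/-- Coefficients of permutation monomials after a row permutation. [folklore] -/
private theorem coeff_permExp_rename_rowPerm (τ π : Equiv.Perm (Fin n)) (p : MvPolynomial (Fin n × Fin n) k) :
    coeff (permExp (τ * π)) (rename (rowPerm τ) p) = coeff (permExp π) p := by
  rw [← mapDomain_rowPerm_permExp]
  exact coeff_rename_mapDomain _ (rowPerm τ).injective _ _

/-- The generic determinant as a sum of monomials with signed coefficients. [folklore] -/
private theorem detPoly_eq_sum' (n : ℕ) :
    detPoly (Fin n) k = ∑ π : Equiv.Perm (Fin n),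
      monomial (permExp π) ((Equiv.Perm.sign π : ℤ) : k) := by
  rw [detPoly_eq_sum]
  refine Finset.sum_congr rfl fun π _ => ?_
  rw [smul_monomial, smul_eq_mul, mul_one]

/-- The weight negating the variables of row class `a₀`. [folklore] -/
private def negRowWeight (a₀ : Fin n) (x : Fin n × Fin n) : k := if x.1 = a₀ then -1 else 1

/-- The row-negating weights are nonzero. [folklore] -/
private theorem negRowWeight_ne_zero (a₀ : Fin n) (x : Fin n × Fin n) : negRowWeight (k := k) a₀ x ≠ 0 := by
  unfold negRowWeight; split_ifs <;> simp

/-- The row negation multiplies every permutation monomial by `-1`. [folklore] -/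
private theorem prod_negRowWeight_permExp (a₀ : Fin n) (π : Equiv.Perm (Fin n)) :
    ∏ i, negRowWeight (k := k) a₀ (π i, i) = -1 := by
  simp only [negRowWeight]
  simp_rw [show ∀ i, (π i = a₀ ↔ i = π.symm a₀) from fun i => π.apply_eq_iff_eq_symm_apply (y := a₀)]
  rw [Finset.prod_ite_eq']
  simp

/-- `sgn(τπ) = -sgn(π)` for a transposition `τ`, cast to the field. [folklore] -/
private theorem cast_sign_swap_mul {a₀ a₁ : Fin n} (hne : a₀ ≠ a₁) (π : Equiv.Perm (Fin n)) :
    ((Equiv.Perm.sign (Equiv.swap a₀ a₁ * π) : ℤ) : k) = -((Equiv.Perm.sign π : ℤ) : k) := by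
  rw [Equiv.Perm.sign_mul, Equiv.Perm.sign_swap hne, Units.val_mul, Units.val_neg, Units.val_one]
  push_cast
  ring

/-- A row transposition composed with a row negation fixes the determinant. [folklore] -/
private theorem linSubst_negRow_rename_swap_detPoly {a₀ a₁ : Fin n} (hne : a₀ ≠ a₁) :
    linSubst _ k (Matrix.diagonal (negRowWeight a₀))
        (rename (rowPerm (Equiv.swap a₀ a₁)) (detPoly (Fin n) k)) = detPoly (Fin n) k := by
  rw [detPoly_eq_sum', map_sum, map_sum]
  simp_rw [rename_rowPerm_monomial_permExp, linSubst_diagonal_monomial', prod_pow_permExp,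
    prod_negRowWeight_permExp, smul_monomial, smul_eq_mul]
  refine Fintype.sum_equiv (Equiv.mulLeft (Equiv.swap a₀ a₁)) _ _ fun π => ?_
  simp only [Equiv.coe_mulLeft]
  rw [cast_sign_swap_mul hne, neg_one_mul]

/-- Fixedness under a signed row transposition forces `c_{τπ} = -c_π`. [folklore] -/
private theorem coeff_permExp_swap_mul {a₀ a₁ : Fin n} (π : Equiv.Perm (Fin n))
    {p : MvPolynomial (Fin n × Fin n) k}
    (hfix : linSubst _ k (Matrix.diagonal (negRowWeight a₀))
        (rename (rowPerm (Equiv.swap a₀ a₁)) p) = p) :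
    coeff (permExp (Equiv.swap a₀ a₁ * π)) p = -coeff (permExp π) p := by
  have h := congrArg (coeff (permExp (Equiv.swap a₀ a₁ * π))) hfix
  rw [coeff_linSubst_diagonal, prod_pow_permExp, prod_negRowWeight_permExp,
    coeff_permExp_rename_rowPerm] at h
  rw [← h, neg_one_mul]

/-! ### Determinants of the substitutions used (they lie in `SL_{n²}`) -/

/-- `permGL θ` has determinant `sgn θ`. [folklore] -/
private theorem det_permGL {σ : Type*} [Fintype σ] [DecidableEq σ] (θ : Equiv.Perm σ) :
    Matrix.det ((permGL θ : GL σ k) : Matrix σ σ k) = ((Equiv.Perm.sign θ : ℤ) : k) := by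
  rw [permGL, Matrix.GeneralLinearGroup.val_mkOfDetNeZero, Matrix.det_permutation,
    Equiv.Perm.sign_inv]

/-- `sgn` of the row permutation `(a, b) ↦ (τ a, b)` of the `n²` indices for even `n` is `1`
(`= sgn(τ)^n`). [folklore] -/
private theorem sign_rowPerm_of_even (hn : Even n) (τ : Equiv.Perm (Fin n)) :
    Equiv.Perm.sign (rowPerm τ) = 1 := by
  rw [rowPerm, Equiv.prodCongr_refl_right, Equiv.Perm.sign_prodCongrLeft, Finset.prod_const,
    Finset.card_univ, Fintype.card_fin, Int.units_pow_eq_pow_mod_two, Nat.even_iff.mp hn, pow_zero]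

/-- `sgn` of the row permutation `(a, b) ↦ (τ a, b)` for odd `n` is `sgn τ`. [folklore] -/
private theorem sign_rowPerm_of_odd (hn : Odd n) (τ : Equiv.Perm (Fin n)) :
    Equiv.Perm.sign (rowPerm τ) = Equiv.Perm.sign τ := by
  rw [rowPerm, Equiv.prodCongr_refl_right, Equiv.Perm.sign_prodCongrLeft, Finset.prod_const,
    Finset.card_univ, Fintype.card_fin, Int.units_pow_eq_pow_mod_two, Nat.odd_iff.mp hn, pow_one]




/-- The row/column scaling `diag(rcWeight a b)` has determinant `1` (`n` entries `2`, `n` entries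
`θ⁻¹`). [folklore] -/
private theorem det_diagGL_rcWeight {θ : k} (hθ : θ ≠ 0) (a b : Fin n) :
    Matrix.det ((diagGL (rcWeight θ a b) (rcWeight_ne_zero hθ a b) : GL (Fin n × Fin n) k) :
      Matrix (Fin n × Fin n) (Fin n × Fin n) k) = 1 := by
  rw [coe_diagGL, Matrix.det_diagonal]
  simp only [rcWeight, Finset.prod_mul_distrib]
  have h1' : ∀ i : Fin n, ∏ _j : Fin n, (if i = a then θ else 1) =
      (if i = a then θ else 1) ^ n := fun i => by
    rw [Finset.prod_const, Finset.card_univ, Fintype.card_fin]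
  have h2' : ∀ j : Fin n, ∏ _i : Fin n, (if j = b then θ⁻¹ else 1) =
      (if j = b then θ⁻¹ else 1) ^ n := fun j => by
    rw [Finset.prod_const, Finset.card_univ, Fintype.card_fin]
  have h1 : ∏ x : Fin n × Fin n, (if x.1 = a then θ else 1) = θ ^ n := by
    rw [Fintype.prod_prod_type]
    simp_rw [h1']
    rw [Finset.prod_pow, Finset.prod_ite_eq']
    simp
  have h2 : ∏ x : Fin n × Fin n, (if x.2 = b then θ⁻¹ else 1) = θ⁻¹ ^ n := by
    rw [Fintype.prod_prod_type_right]
    simp_rw [h2']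
    rw [Finset.prod_pow, Finset.prod_ite_eq']
    simp
  rw [h1, h2, ← mul_pow, mul_inv_cancel₀ hθ, one_pow]


/-- The row negation `diag(negRowWeight a₀)` has determinant `(-1)^n`. [folklore] -/
private theorem det_diagGL_negRowWeight (a₀ : Fin n) :
    Matrix.det ((diagGL (negRowWeight a₀) (negRowWeight_ne_zero a₀) : GL (Fin n × Fin n) k) :
      Matrix (Fin n × Fin n) (Fin n × Fin n) k) = (-1) ^ n := by
  rw [coe_diagGL, Matrix.det_diagonal]
  simp only [negRowWeight]
  have h' : ∀ i : Fin n, ∏ _j : Fin n, (if i = a₀ then (-1 : k) else 1) =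
      (if i = a₀ then (-1 : k) else 1) ^ n := fun i => by
    rw [Finset.prod_const, Finset.card_univ, Fintype.card_fin]
  rw [Fintype.prod_prod_type]
  simp_rw [h']
  rw [Finset.prod_pow, Finset.prod_ite_eq']
  simp

/-- The signed row transposition `X_{ab} ↦ (-1)^{[a=a₀]} X_{swap(a₀,a₁) a, b}` has determinant `1`
(`(-1)^n · sgn(swap)^n`). [folklore] -/
private theorem det_negRow_mul_swap {a₀ a₁ : Fin n} (hne : a₀ ≠ a₁) :
    Matrix.det (((diagGL (negRowWeight a₀) (negRowWeight_ne_zero a₀) *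
      permGL (rowPerm (Equiv.swap a₀ a₁)) : GL (Fin n × Fin n) k) :
        Matrix (Fin n × Fin n) (Fin n × Fin n) k)) = 1 := by
  rw [Units.val_mul, Matrix.det_mul, det_diagGL_negRowWeight, det_permGL]
  rcases Nat.even_or_odd n with he | ho
  · rw [sign_rowPerm_of_even he, Units.val_one, Int.cast_one, mul_one, he.neg_one_pow]
  · rw [sign_rowPerm_of_odd ho, Equiv.Perm.sign_swap hne, Units.val_neg, Units.val_one, Int.cast_neg,
      Int.cast_one, ho.neg_one_pow, neg_mul_neg, one_mul]

/-- Roots of unity of order `≤ n`, together with `0`, miss some element of an infinite field. [folklore] -/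
private theorem exists_pow_ne_one [Infinite k] (n : ℕ) :
    ∃ θ : k, θ ≠ 0 ∧ ∀ j, 0 < j → j ≤ n → θ ^ j ≠ 1 := by
  classical
  let T : Finset k := insert 0 ((Finset.range (n + 1)).biUnion fun j =>
    ((Polynomial.X ^ j - Polynomial.C (1 : k)).roots).toFinset)
  obtain ⟨θ, hθ⟩ := Infinite.exists_notMem_finset T
  refine ⟨θ, fun h => hθ (by rw [h]; exact Finset.mem_insert_self _ _), fun j hj hjn hpow => hθ ?_⟩
  refine Finset.mem_insert_of_mem (Finset.mem_biUnion.mpr ⟨j, Finset.mem_range.mpr (by omega), ?_⟩)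
  rw [Multiset.mem_toFinset, Polynomial.mem_roots (Polynomial.X_pow_sub_C_ne_zero hj 1)]
  simp [hpow]

/-- **Characteristic-free form** of `CharacterizedByStabilizer.detPoly_eq_smul_of_fixed_of_det_eq_one`:
over any INFINITE field `k` (any characteristic), a form of degree `n` in the `n²` matrix variables
fixed by every `γ ∈ GL_{n²}(k)` with `det γ = 1` that fixes `det_n` is a scalar multiple of
`det_n`. Same argument with the torus weights `θ^{[a=a₀]} θ^{-[b=b₀]}` for an element `θ` that is
not a root of unity of order `≤ n` (such `θ` exists in an infinite field), instead of `2`.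
[cite: MulmuleySohoniSIAM2001, Prop. 4.2 (AV p.13, all.txt L827)] -/
theorem detPoly_eq_smul_of_fixed_of_det_eq_one_of_infinite [Infinite k]
    (p : MvPolynomial (Fin n × Fin n) k) (hp : p.IsHomogeneous n)
    (hfix : ∀ γ : GL (Fin n × Fin n) k,
      Matrix.det (γ : Matrix (Fin n × Fin n) (Fin n × Fin n) k) = 1 →
      linSubstRep _ k γ (detPoly (Fin n) k) = detPoly (Fin n) k → linSubstRep _ k γ p = p) :
    ∃ c : k, p = c • detPoly (Fin n) k := by
  obtain ⟨θ, hθ, hθn⟩ := exists_pow_ne_one (k := k) n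
  have hdiag : ∀ a b : Fin n, linSubst _ k (Matrix.diagonal (rcWeight θ a b)) p = p := fun a b => by
    have h := hfix (diagGL (rcWeight θ a b) (rcWeight_ne_zero hθ a b)) (det_diagGL_rcWeight hθ a b)
      (by rw [linSubstRep_diagGL, linSubst_rcDiag_detPoly hθ])
    rwa [linSubstRep_diagGL] at h
  have hsupp : ∀ e ∈ p.support, ∃ π : Equiv.Perm (Fin n), e = permExp π :=
    fun e he => exists_perm_of_mem_support hθ hθn hp hdiag he
  have hswap : ∀ a₀ a₁ : Fin n, a₀ ≠ a₁ → ∀ π : Equiv.Perm (Fin n),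
      coeff (permExp (Equiv.swap a₀ a₁ * π)) p = -coeff (permExp π) p := by
    intro a₀ a₁ hne π
    refine coeff_permExp_swap_mul π ?_
    have h := hfix (diagGL (negRowWeight a₀) (negRowWeight_ne_zero a₀) *
        permGL (rowPerm (Equiv.swap a₀ a₁))) (det_negRow_mul_swap hne)
      (by rw [map_mul, Module.End.mul_apply, linSubstRep_permGL, linSubstRep_diagGL,
            linSubst_negRow_rename_swap_detPoly hne])
    rwa [map_mul, Module.End.mul_apply, linSubstRep_permGL, linSubstRep_diagGL] at h
  have hsign : ∀ π : Equiv.Perm (Fin n),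
      coeff (permExp π) p = ((Equiv.Perm.sign π : ℤ) : k) * coeff (permExp 1) p := by
    intro π
    induction π using Equiv.Perm.swap_induction_on with
    | one => simp
    | swap_mul f x y hxy ih => rw [hswap x y hxy f, ih, cast_sign_swap_mul hxy, neg_mul]
  refine ⟨coeff (permExp 1) p, ?_⟩
  conv_lhs => rw [eq_sum_monomial_permExp hsupp]
  rw [detPoly_eq_sum', Finset.smul_sum]
  refine Finset.sum_congr rfl fun π _ => ?_
  rw [hsign π, smul_monomial, smul_eq_mul, mul_comm]

end MS2001CharP

/-- **Discharge of `MS2001_prop_4_2`** (GCT I, Prop. 4.2, every algebraically closed field of any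
characteristic): an algebraically closed field is infinite, and
`MS2001CharP.detPoly_eq_smul_of_fixed_of_det_eq_one_of_infinite` applies.
[cite: MulmuleySohoniSIAM2001, Prop. 4.2 (AV p.13, all.txt L827)] -/
theorem MS2001_prop_4_2_holds : MS2001_prop_4_2 := by
  intro F _ _ m
  haveI : Infinite F := IsAlgClosed.instInfinite
  exact fun p hp hfix => MS2001CharP.detPoly_eq_smul_of_fixed_of_det_eq_one_of_infinite p hp
    fun γ hdet hfixdet => hfix γ (mem_slSubgroup_iff.mpr hdet) hfixdet


/-! ## The stabilizers of `det_m` and `per_n` in `SL` act irreducibly on the matrix space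
(the claims made in the proofs of Thms. 4.6 and 4.7)

GCT I proves Thms. 4.6/4.7 in two lines each: the stabilizer is "not contained in any (proper)
parabolic subgroup of `G`, because its representation over the space of `m × m` matrices given by
eq. (4) is irreducible. So stability follows from the Kempf's criterion" (AV p.15, all.txt
L941–943, L958–962). Kempf's criterion is not in the tree (the theorems stay named facts); the
irreducibility claims are proved here, for the defining action `w ↦ γ w` of `GL(σ)` on coordinate
vectors `σ → k`, `σ = Fin m × Fin m` (the degree-one part of `linSubstRep`: `linSubst A` maps the
linear form with coefficient vector `c` to the one with coefficient vector `A c`). A parabolic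
subgroup of `SL_N` stabilizes a flag, so a subgroup acting irreducibly on `k^N` lies in no proper
parabolic; that deduction is not formalized (Mathlib has no parabolic subgroups). -/

section StabilizerIrreducible

open scoped Kronecker

variable {k : Type*} [Field k] {m : ℕ}

/-- `a ⊗ b` with `det a = det b = 1`, as an element of `GL_{m²}` coming from `SL_{m²}`
(BLMW 2011 §5.2: `S(GL(E) × GL(F)) ⊂ Stab(det)`). [folklore] -/
private def kronSL (a b : Matrix (Fin m) (Fin m) k) (ha : a.det = 1) (hb : b.det = 1) :
    GL (Fin m × Fin m) k :=
  Matrix.SpecialLinearGroup.toGL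
    ⟨a ⊗ₖ b, by rw [Matrix.det_kronecker, ha, hb, one_pow, mul_one]⟩

/-- Underlying matrix of `kronSL`. [folklore] -/
private theorem coe_kronSL (a b : Matrix (Fin m) (Fin m) k) (ha : a.det = 1) (hb : b.det = 1) :
    ((kronSL a b ha hb : GL (Fin m × Fin m) k) : Matrix (Fin m × Fin m) (Fin m × Fin m) k) = a ⊗ₖ b :=
  rfl

/-- `a ⊗ b` (`det a = det b = 1`) lies in `SL_{m²} ∩ Stab(det_m)`: it maps `X ↦ aᵀ X b`
(`linSubst_kronecker_detPoly`). [folklore] -/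
private theorem kronSL_mem (a b : Matrix (Fin m) (Fin m) k) (ha : a.det = 1) (hb : b.det = 1) :
    kronSL a b ha hb ∈ slSubgroup (Fin m × Fin m) k ⊓ linStabilizer (detPoly (Fin m) k) := by
  refine Subgroup.mem_inf.mpr ⟨⟨_, rfl⟩, ?_⟩
  rw [mem_linStabilizer, linSubstRep_apply, coe_kronSL,
    Literature.NumberTheory.DiophantineGeometry.linSubst_kronecker_detPoly, ha, hb, mul_one,
    one_smul]

/-- `(a ⊗ 1) · w` is left multiplication of the matrix `w` by `a`. [folklore] -/
private theorem kronecker_one_mulVec (a : Matrix (Fin m) (Fin m) k) (w : Fin m × Fin m → k)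
    (x : Fin m × Fin m) :
    (a ⊗ₖ (1 : Matrix (Fin m) (Fin m) k)).mulVec w x = (a * Matrix.of fun r c => w (r, c)) x.1 x.2 := by
  simp only [Matrix.mulVec, dotProduct, Matrix.kroneckerMap_apply, Fintype.sum_prod_type,
    Matrix.mul_apply, Matrix.of_apply, Matrix.one_apply, mul_ite, mul_one, mul_zero, ite_mul,
    zero_mul, Finset.sum_ite_eq, Finset.mem_univ, if_true]

/-- `(1 ⊗ b) · w` is right multiplication of the matrix `w` by `bᵀ`. [folklore] -/
private theorem one_kronecker_mulVec (b : Matrix (Fin m) (Fin m) k) (w : Fin m × Fin m → k)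
    (x : Fin m × Fin m) :
    ((1 : Matrix (Fin m) (Fin m) k) ⊗ₖ b).mulVec w x = ((Matrix.of fun r c => w (r, c)) * b.transpose) x.1 x.2 := by
  simp only [Matrix.mulVec, dotProduct, Matrix.kroneckerMap_apply, Fintype.sum_prod_type_right,
    Matrix.mul_apply, Matrix.of_apply, Matrix.one_apply, Matrix.transpose_apply, ite_mul, one_mul,
    zero_mul, Finset.sum_ite_eq, Finset.mem_univ, if_true, mul_comm (w _)]

section Moves

variable {W : Submodule k (Fin m × Fin m → k)}
  (hW : ∀ γ ∈ slSubgroup (Fin m × Fin m) k ⊓ linStabilizer (detPoly (Fin m) k),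
    ∀ w ∈ W, (γ : Matrix (Fin m × Fin m) (Fin m × Fin m) k).mulVec w ∈ W)
include hW

/-- Row move: with `w ∈ W`, the matrix whose row `r` is row `i` of `w` (`r ≠ i`) and whose other
rows vanish lies in `W` (it is `(T ⊗ 1) w − w` for the transvection `T = 1 + E_{ri}`). [folklore] -/
private theorem rowMove_mem {w : Fin m × Fin m → k} (hw : w ∈ W) {r i : Fin m} (hri : r ≠ i) :
    (fun x : Fin m × Fin m => if x.1 = r then w (i, x.2) else 0) ∈ W := by
  have h1 := hW _ (kronSL_mem (Matrix.transvection r i 1) 1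
    (Matrix.det_transvection_of_ne r i hri 1) Matrix.det_one) w hw
  convert W.sub_mem h1 hw using 1
  funext x
  rw [Pi.sub_apply, coe_kronSL, kronecker_one_mulVec]
  by_cases hx : x.1 = r
  · rw [if_pos hx, hx, Matrix.transvection_mul_apply_same, Matrix.of_apply, Matrix.of_apply, one_mul,
      ← hx, add_sub_cancel_left]
  · rw [if_neg hx, Matrix.transvection_mul_apply_of_ne r i x.1 x.2 hx, Matrix.of_apply, sub_self]

/-- Column move: with `w ∈ W`, the matrix whose column `q` is column `j` of `w` (`q ≠ j`) and whose
other columns vanish lies in `W`. [folklore] -/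
private theorem colMove_mem {w : Fin m × Fin m → k} (hw : w ∈ W) {q j : Fin m} (hqj : q ≠ j) :
    (fun x : Fin m × Fin m => if x.2 = q then w (x.1, j) else 0) ∈ W := by
  have h1 := hW _ (kronSL_mem 1 (Matrix.transvection q j 1) Matrix.det_one
    (Matrix.det_transvection_of_ne q j hqj 1)) w hw
  convert W.sub_mem h1 hw using 1
  funext x
  rw [Pi.sub_apply, coe_kronSL, one_kronecker_mulVec]
  have ht : (Matrix.transvection q j (1 : k)).transpose = Matrix.transvection j q 1 := by
    rw [Matrix.transvection, Matrix.transvection, Matrix.transpose_add, Matrix.transpose_one,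
      Matrix.transpose_single]
  rw [ht]
  by_cases hx : x.2 = q
  · rw [if_pos hx, hx, Matrix.mul_transvection_apply_same, Matrix.of_apply, Matrix.of_apply, one_mul,
      ← hx, add_sub_cancel_left]
  · rw [if_neg hx, Matrix.mul_transvection_apply_of_ne j q x.1 x.2 hx, Matrix.of_apply, sub_self]

/-- If one elementary matrix `E_{(r₀,q₀)}` lies in `W`, all of them do (row move, then column
move). [folklore] -/
private theorem single_mem_of_single_mem {x₀ : Fin m × Fin m}
    (h : (Pi.single x₀ 1 : Fin m × Fin m → k) ∈ W) (x : Fin m × Fin m) :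
    (Pi.single x 1 : Fin m × Fin m → k) ∈ W := by
  -- first move the row, then the column
  have hrow : (Pi.single (x.1, x₀.2) 1 : Fin m × Fin m → k) ∈ W := by
    by_cases hr : x.1 = x₀.1
    · rw [hr]; exact h
    · convert rowMove_mem hW h hr using 1
      funext y
      by_cases hy : y = (x.1, x₀.2)
      · subst hy; simp
      · rw [Pi.single_eq_of_ne hy]
        by_cases hy1 : y.1 = x.1
        · have hy2 : y.2 ≠ x₀.2 := fun h2 => hy (Prod.ext hy1 h2)
          have hne : (x₀.1, y.2) ≠ x₀ := fun h' => hy2 (congrArg Prod.snd h' :)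
          rw [if_pos hy1, Pi.single_eq_of_ne hne]
        · rw [if_neg hy1]
  by_cases hc : x.2 = x₀.2
  · have : x = (x.1, x₀.2) := Prod.ext rfl hc
    rw [this]; exact hrow
  · convert colMove_mem hW hrow hc using 1
    funext y
    by_cases hy : y = x
    · subst hy; simp
    · rw [Pi.single_eq_of_ne hy]
      by_cases hy2 : y.2 = x.2
      · have hy1 : y.1 ≠ x.1 := fun h1 => hy (Prod.ext h1 hy2)
        have hne : (y.1, x₀.2) ≠ (x.1, x₀.2) := fun h' => hy1 (congrArg Prod.fst h' :)
        rw [if_pos hy2, Pi.single_eq_of_ne hne]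
      · rw [if_neg hy2]

end Moves

/-- A subspace of `k^σ` containing every elementary vector is everything. [folklore] -/
private theorem eq_top_of_forall_single_mem {W : Submodule k (Fin m × Fin m → k)}
    (h : ∀ x : Fin m × Fin m, (Pi.single x 1 : Fin m × Fin m → k) ∈ W) : W = ⊤ := by
  refine Submodule.eq_top_iff'.mpr fun v => ?_
  rw [pi_eq_sum_univ' v]
  exact W.sum_mem fun x _ => W.smul_mem _ (h x)

/-- **The stabilizer of `det_m` in `SL_{m²}` acts irreducibly on `M_m`** (Mulmuley–Sohoni 2001,
proof of Thm. 4.6: "the representation of `R` on the space of `m × m` matrices (eq. (4)) is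
irreducible"). Typed for the defining action `w ↦ γ w` of `GL_{m²}` on coordinate vectors
`w : Fin m × Fin m → k` (the degree-one part of the tree's `linSubstRep`): a subspace invariant
under every `γ ∈ SL_{m²}(k)` fixing `det_m` is `0` or everything; any field, any `m`. Proof: the
Kronecker transvections `(1 + E_{ri}) ⊗ 1`, `1 ⊗ (1 + E_{qj})` have determinant one and fix
`det_m` (`linSubst_kronecker_detPoly`); they move a nonzero entry of `w ∈ W` to an elementary
matrix in `W`, and then to every elementary matrix.
[cite: MulmuleySohoniSIAM2001, proof of Thm. 4.6 = journal Thm. 4.1 (AV p.15, all.txt L941–943)] -/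
theorem MS2001_detStabilizer_irreducible (W : Submodule k (Fin m × Fin m → k))
    (hW : ∀ γ ∈ slSubgroup (Fin m × Fin m) k ⊓ linStabilizer (detPoly (Fin m) k),
      ∀ w ∈ W, (γ : Matrix (Fin m × Fin m) (Fin m × Fin m) k).mulVec w ∈ W) :
    W = ⊥ ∨ W = ⊤ := by
  rcases eq_or_ne W ⊥ with h | h
  · exact Or.inl h
  right
  obtain ⟨w, hw, hw0⟩ := (Submodule.ne_bot_iff W).mp h
  obtain ⟨x₀, hx₀⟩ := Function.ne_iff.mp hw0
  rw [Pi.zero_apply] at hx₀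
  apply eq_top_of_forall_single_mem
  -- an elementary matrix in `W`
  rcases subsingleton_or_nontrivial (Fin m) with hm | hm
  · -- `m ≤ 1`: `w` itself is a multiple of `E_{x₀}`
    have hws : (Pi.single x₀ 1 : Fin m × Fin m → k) = (w x₀)⁻¹ • w := by
      funext y
      have : y = x₀ := Subsingleton.elim _ _
      subst this
      simp [inv_mul_cancel₀ hx₀]
    have hx : (Pi.single x₀ 1 : Fin m × Fin m → k) ∈ W := by
      rw [hws]
      exact W.smul_mem _ hw
    exact single_mem_of_single_mem hW hx
  · obtain ⟨r, hr⟩ := exists_ne x₀.1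
    obtain ⟨q, hq⟩ := exists_ne x₀.2
    have h1 := rowMove_mem hW hw hr
    have h2 := colMove_mem hW h1 hq
    have hE : (fun x : Fin m × Fin m => if x.2 = q then
        (fun y : Fin m × Fin m => if y.1 = r then w (x₀.1, y.2) else 0) (x.1, x₀.2) else 0) =
        w x₀ • (Pi.single (r, q) 1 : Fin m × Fin m → k) := by
      funext x
      by_cases hx : x = (r, q)
      · subst hx; simp
      · rw [Pi.smul_apply, Pi.single_eq_of_ne hx, smul_zero]
        by_cases hx2 : x.2 = q
        · have hx1 : x.1 ≠ r := fun h1 => hx (Prod.ext h1 hx2)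
          rw [if_pos hx2]; dsimp only; rw [if_neg hx1]
        · rw [if_neg hx2]
    rw [hE] at h2
    have hx : (Pi.single (r, q) 1 : Fin m × Fin m → k) ∈ W := by
      have := W.smul_mem (w x₀)⁻¹ h2
      rwa [smul_smul, inv_mul_cancel₀ hx₀, one_smul] at this
    exact single_mem_of_single_mem hW hx

end StabilizerIrreducible

namespace MS2001CharP

variable {k : Type*} [Field k] {n : ℕ}

/-! ### The stabilizer of `per_n` in `SL_{n²}` acts irreducibly on `M_n` (proof of Thm. 4.7) -/

/-- The generic permanent as a sum of permutation monomials. [folklore] -/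
private theorem perPoly_eq_sum' (n : ℕ) :
    perPoly (Fin n) k = ∑ π : Equiv.Perm (Fin n), monomial (permExp π) 1 := by
  unfold perPoly Matrix.permanent
  refine Finset.sum_congr rfl fun π _ => ?_
  rw [← prod_X_eq_monomial_permExp]
  rfl

/-- The row/column scalings fix the permanent. [folklore] -/
private theorem linSubst_rcDiag_perPoly {θ : k} (hθ : θ ≠ 0) (a b : Fin n) :
    linSubst _ k (Matrix.diagonal (rcWeight θ a b)) (perPoly (Fin n) k) = perPoly (Fin n) k := by
  rw [perPoly_eq_sum', map_sum]
  simp_rw [linSubst_rcDiag_monomial_permExp hθ]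

/-- Row permutations fix the permanent. [folklore] -/
private theorem rename_rowPerm_perPoly' (τ : Equiv.Perm (Fin n)) :
    rename (rowPerm τ) (perPoly (Fin n) k) = perPoly (Fin n) k := by
  rw [perPoly_eq_sum', map_sum]
  simp_rw [rename_rowPerm_monomial_permExp]
  exact Fintype.sum_equiv (Equiv.mulLeft τ) _ _ fun π => rfl

/-- Column permutation of the variable indices: `(a, b) ↦ (a, υ b)`. [folklore] -/
private def colPerm (υ : Equiv.Perm (Fin n)) : Equiv.Perm (Fin n × Fin n) :=
  Equiv.prodCongr (Equiv.refl _) υ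

/-- Value of the column permutation of indices. [folklore] -/
@[simp] private theorem colPerm_apply (υ : Equiv.Perm (Fin n)) (x : Fin n × Fin n) :
    colPerm υ x = (x.1, υ x.2) := rfl

/-- Column permutation of a permutation pattern: `permExp π ↦ permExp (π υ⁻¹)`. [folklore] -/
private theorem mapDomain_colPerm_permExp (υ π : Equiv.Perm (Fin n)) :
    Finsupp.mapDomain (colPerm υ) (permExp π) = permExp (π * υ⁻¹) := by
  unfold permExp
  rw [Finsupp.mapDomain_finsetSum]
  simp only [Finsupp.mapDomain_single, colPerm_apply, Equiv.Perm.mul_apply]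
  exact Fintype.sum_equiv υ _ _ fun i => by simp

/-- Column permutations fix the permanent. [folklore] -/
private theorem rename_colPerm_perPoly (υ : Equiv.Perm (Fin n)) :
    rename (colPerm υ) (perPoly (Fin n) k) = perPoly (Fin n) k := by
  rw [perPoly_eq_sum', map_sum]
  simp_rw [rename_monomial, mapDomain_colPerm_permExp]
  exact Fintype.sum_equiv (Equiv.mulRight υ⁻¹) _ _ fun π => rfl

/-- `sgn` of the column permutation `(a, b) ↦ (a, υ b)` of the `n²` indices for even `n` is `1`. [folklore] -/
private theorem sign_colPerm_of_even (hn : Even n) (υ : Equiv.Perm (Fin n)) :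
    Equiv.Perm.sign (colPerm υ) = 1 := by
  rw [colPerm, Equiv.prodCongr_refl_left, Equiv.Perm.sign_prodCongrRight, Finset.prod_const,
    Finset.card_univ, Fintype.card_fin, Int.units_pow_eq_pow_mod_two, Nat.even_iff.mp hn, pow_zero]

/-- `sgn` of the column permutation `(a, b) ↦ (a, υ b)` for odd `n` is `sgn υ`. [folklore] -/
private theorem sign_colPerm_of_odd (hn : Odd n) (υ : Equiv.Perm (Fin n)) :
    Equiv.Perm.sign (colPerm υ) = Equiv.Perm.sign υ := by
  rw [colPerm, Equiv.prodCongr_refl_left, Equiv.Perm.sign_prodCongrRight, Finset.prod_const,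
    Finset.card_univ, Fintype.card_fin, Int.units_pow_eq_pow_mod_two, Nat.odd_iff.mp hn, pow_one]

/-- Row permutations along `τ` with `sgn τ = 1` (or any `τ`, for even `n`) have sign `1` on the
`n²` indices. [folklore] -/
private theorem sign_rowPerm_eq_one {τ : Equiv.Perm (Fin n)} (h : Equiv.Perm.sign τ = 1 ∨ Even n) :
    Equiv.Perm.sign (rowPerm τ) = 1 := by
  rcases Nat.even_or_odd n with he | ho
  · exact sign_rowPerm_of_even he τ
  · rw [sign_rowPerm_of_odd ho]
    exact h.resolve_right (Nat.not_even_iff_odd.mpr ho)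

/-- Column permutations along `υ` with `sgn υ = 1` (or any `υ`, for even `n`) have sign `1` on the
`n²` indices. [folklore] -/
private theorem sign_colPerm_eq_one {υ : Equiv.Perm (Fin n)} (h : Equiv.Perm.sign υ = 1 ∨ Even n) :
    Equiv.Perm.sign (colPerm υ) = 1 := by
  rcases Nat.even_or_odd n with he | ho
  · exact sign_colPerm_of_even he υ
  · rw [sign_colPerm_of_odd ho]
    exact h.resolve_right (Nat.not_even_iff_odd.mpr ho)

/-- A torus scaling `diag(rcWeight θ a b)` lies in `SL_{n²} ∩ Stab(per_n)`. [folklore] -/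
private theorem diagGL_rcWeight_mem_per {θ : k} (hθ : θ ≠ 0) (a b : Fin n) :
    diagGL (rcWeight θ a b) (rcWeight_ne_zero hθ a b) ∈
      slSubgroup (Fin n × Fin n) k ⊓ linStabilizer (perPoly (Fin n) k) := by
  refine Subgroup.mem_inf.mpr ⟨mem_slSubgroup_iff.mpr (det_diagGL_rcWeight hθ a b), ?_⟩
  rw [mem_linStabilizer, linSubstRep_diagGL, linSubst_rcDiag_perPoly hθ]

/-- An index permutation of sign `1` fixing `per_n` gives an element of `SL_{n²} ∩ Stab(per_n)`. [folklore] -/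
private theorem permGL_mem_per {ρ : Equiv.Perm (Fin n × Fin n)} (hsign : Equiv.Perm.sign ρ = 1)
    (hfix : rename ρ (perPoly (Fin n) k) = perPoly (Fin n) k) :
    (permGL ρ : GL (Fin n × Fin n) k) ∈
      slSubgroup (Fin n × Fin n) k ⊓ linStabilizer (perPoly (Fin n) k) := by
  refine Subgroup.mem_inf.mpr ⟨mem_slSubgroup_iff.mpr ?_, ?_⟩
  · rw [det_permGL, hsign, Units.val_one, Int.cast_one]
  · rw [mem_linStabilizer, linSubstRep_permGL, hfix]

/-- A diagonal element acts on coordinate vectors entrywise. [folklore] -/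
private theorem diagGL_mulVec {σ : Type*} [Fintype σ] [DecidableEq σ] (β : σ → k)
    (hβ : ∀ x, β x ≠ 0) (w : σ → k) :
    ((diagGL β hβ : GL σ k) : Matrix σ σ k).mulVec w = fun x => β x * w x := by
  funext x
  rw [coe_diagGL, Matrix.mulVec_diagonal]

/-- `permGL ρ` moves the elementary vector `E_y` to `E_{ρ y}`. [folklore] -/
private theorem permGL_mulVec_single {σ : Type*} [Fintype σ] [DecidableEq σ] (ρ : Equiv.Perm σ)
    (y : σ) :
    ((permGL ρ : GL σ k) : Matrix σ σ k).mulVec (Pi.single y 1) = Pi.single (ρ y) 1 := by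
  rw [permGL, Matrix.GeneralLinearGroup.val_mkOfDetNeZero, Matrix.permMatrix_mulVec]
  funext x
  simp only [Function.comp_apply, Pi.single_apply, Equiv.Perm.inv_def, Equiv.symm_apply_eq]

/-- For `i ≠ i'` in `Fin n` there is a permutation `τ` with `τ i = i'` that is even unless `n` is
(a transposition if `n` is even; a `3`-cycle if `n` is odd, hence `≥ 3`). [folklore] -/
private theorem exists_perm_apply_eq {i i' : Fin n} (hii' : i ≠ i') :
    ∃ τ : Equiv.Perm (Fin n), τ i = i' ∧ (Equiv.Perm.sign τ = 1 ∨ Even n) := by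
  rcases Nat.even_or_odd n with he | ho
  · exact ⟨Equiv.swap i i', Equiv.swap_apply_left i i', Or.inr he⟩
  · have h3 : ({i, i'} : Finset (Fin n)).card < (Finset.univ : Finset (Fin n)).card := by
      have h2 := Fintype.one_lt_card_iff_nontrivial.mpr ⟨⟨i, i', hii'⟩⟩
      rw [Fintype.card_fin] at h2
      rw [Finset.card_pair hii', Finset.card_univ, Fintype.card_fin]
      rcases ho with ⟨r, hr⟩
      omega
    obtain ⟨i'', -, hi''⟩ := Finset.exists_mem_notMem_of_card_lt_card h3
    simp only [Finset.mem_insert, Finset.mem_singleton, not_or] at hi''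
    refine ⟨Equiv.swap i i' * Equiv.swap i' i'', ?_, Or.inl ?_⟩
    · rw [Equiv.Perm.mul_apply, Equiv.swap_apply_of_ne_of_ne hii' (Ne.symm hi''.1),
        Equiv.swap_apply_left]
    · rw [Equiv.Perm.sign_mul, Equiv.Perm.sign_swap hii', Equiv.Perm.sign_swap (Ne.symm hi''.2),
        Int.units_mul_self]

section PerMoves

variable {W : Submodule k (Fin n × Fin n → k)}
  (hW : ∀ γ ∈ slSubgroup (Fin n × Fin n) k ⊓ linStabilizer (perPoly (Fin n) k),
    ∀ w ∈ W, (γ : Matrix (Fin n × Fin n) (Fin n × Fin n) k).mulVec w ∈ W)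
include hW

/-- Torus filter: with `w ∈ W` also `x ↦ (β x − c₁)(β x − c₂) w x` lies in `W`, `β = rcWeight θ a b`
(a polynomial in the scaling operator, applied to `w`). [folklore] -/
private theorem torusFilter_mem {θ : k} (hθ : θ ≠ 0) (a b : Fin n) (c₁ c₂ : k)
    {w : Fin n × Fin n → k} (hw : w ∈ W) :
    (fun x => (rcWeight θ a b x - c₁) * (rcWeight θ a b x - c₂) * w x) ∈ W := by
  have step : ∀ (c : k) {v : Fin n × Fin n → k}, v ∈ W →
      (fun x => (rcWeight θ a b x - c) * v x) ∈ W := by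
    intro c v hv
    have h1 := hW _ (diagGL_rcWeight_mem_per hθ a b) v hv
    rw [diagGL_mulVec] at h1
    convert W.sub_mem h1 (W.smul_mem c hv) using 1
    funext x
    simp only [Pi.sub_apply, Pi.smul_apply, smul_eq_mul]
    ring
  convert step c₂ (step c₁ hw) using 1
  funext x
  ring

/-- Two torus filters isolate an entry: `w ∈ W`, `w x₀ ≠ 0`, `n ≥ 2` ⇒ `E_{x₀} ∈ W`
(`θ ≠ 0, 1` with `θ² ≠ 1`). [folklore] -/
private theorem single_mem_of_apply_ne_zero_per {θ : k} (hθ : θ ≠ 0) (hθ1 : θ ≠ 1)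
    (hθ2 : θ ^ 2 ≠ 1) {w : Fin n × Fin n → k} (hw : w ∈ W) {x₀ : Fin n × Fin n} (hx₀ : w x₀ ≠ 0)
    {a₁ b₁ : Fin n} (ha : a₁ ≠ x₀.1) (hb : b₁ ≠ x₀.2) :
    (Pi.single x₀ 1 : Fin n × Fin n → k) ∈ W := by
  have h2 := torusFilter_mem hW hθ a₁ x₀.2 1 θ (torusFilter_mem hW hθ x₀.1 b₁ 1 θ⁻¹ hw)
  have hθinv : θ⁻¹ ≠ θ := fun h => hθ2 (by rw [pow_two, ← inv_mul_cancel₀ hθ, h])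
  set C : k := (θ⁻¹ - 1) * (θ⁻¹ - θ) * ((θ - 1) * (θ - θ⁻¹) * w x₀) with hC
  have hCne : C ≠ 0 := by
    refine mul_ne_zero (mul_ne_zero (sub_ne_zero.mpr fun h => hθ1 (inv_eq_one.mp h))
      (sub_ne_zero.mpr hθinv)) (mul_ne_zero (mul_ne_zero (sub_ne_zero.mpr hθ1)
      (sub_ne_zero.mpr (Ne.symm hθinv))) hx₀)
  have hfun : (fun x => (rcWeight θ a₁ x₀.2 x - 1) * (rcWeight θ a₁ x₀.2 x - θ) *
      ((rcWeight θ x₀.1 b₁ x - 1) * (rcWeight θ x₀.1 b₁ x - θ⁻¹) * w x)) =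
      C • (Pi.single x₀ 1 : Fin n × Fin n → k) := by
    funext x
    by_cases hx : x = x₀
    · subst hx
      simp only [rcWeight, if_neg (Ne.symm ha), if_neg (Ne.symm hb), ↓reduceIte, one_mul, mul_one,
        Pi.smul_apply, Pi.single_eq_same, smul_eq_mul, hC]
    · rw [Pi.smul_apply, Pi.single_eq_of_ne hx, smul_zero]
      by_cases hx1 : x.1 = x₀.1
      · have hx2 : x.2 ≠ x₀.2 := fun h' => hx (Prod.ext hx1 h')
        have hxa : x.1 ≠ a₁ := hx1 ▸ Ne.symm ha
        simp only [rcWeight, if_neg hxa, if_neg hx2, mul_one, sub_self, zero_mul]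
      · simp only [rcWeight, if_neg hx1, one_mul]
        split_ifs <;> simp
  rw [hfun] at h2
  have := W.smul_mem C⁻¹ h2
  rwa [smul_smul, inv_mul_cancel₀ hCne, one_smul] at this

/-- Row move: `E_{(i,j)} ∈ W ⇒ E_{(i',j)} ∈ W`. [folklore] -/
private theorem single_rowMove_per {i i' j : Fin n} (hii' : i ≠ i')
    (h : (Pi.single (i, j) 1 : Fin n × Fin n → k) ∈ W) :
    (Pi.single (i', j) 1 : Fin n × Fin n → k) ∈ W := by
  obtain ⟨τ, hτ, hsign⟩ := exists_perm_apply_eq hii'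
  have hmem := permGL_mem_per (k := k) (sign_rowPerm_eq_one hsign) (rename_rowPerm_perPoly' τ)
  have := hW _ hmem _ h
  rwa [permGL_mulVec_single, rowPerm_apply, hτ] at this

/-- Column move: `E_{(i,j)} ∈ W ⇒ E_{(i,j')} ∈ W`. [folklore] -/
private theorem single_colMove_per {i j j' : Fin n} (hjj' : j ≠ j')
    (h : (Pi.single (i, j) 1 : Fin n × Fin n → k) ∈ W) :
    (Pi.single (i, j') 1 : Fin n × Fin n → k) ∈ W := by
  obtain ⟨υ, hυ, hsign⟩ := exists_perm_apply_eq hjj'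
  have hmem := permGL_mem_per (k := k) (sign_colPerm_eq_one hsign) (rename_colPerm_perPoly υ)
  have := hW _ hmem _ h
  rwa [permGL_mulVec_single, colPerm_apply, hυ] at this

end PerMoves

end MS2001CharP

/-- **The stabilizer of `per_n` in `SL_{n²}` acts irreducibly on `M_n`** (Mulmuley–Sohoni 2001,
proof of Thm. 4.7: "the stabilizer of `perm(X)` in `SL_n(F)` is, again, not contained in a proper
parabolic subgroup, because the space of `n × n` matrices is its irreducible representation").
Typed, like `MS2001_detStabilizer_irreducible`, for the defining action `w ↦ γ w` on coordinate
vectors `w : Fin n × Fin n → k`, over any INFINITE field: a subspace invariant under every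
`γ ∈ SL_{n²}(k)` fixing `per_n` is `0` or everything. Proof: the torus scalings
`diag(θ^{[a=a₀]} θ^{-[b=b₀]})` (determinant one, fixing `per_n`; `θ ≠ 0, ±1`) cut a nonzero
`w ∈ W` down to an elementary matrix, and row/column permutations of sign `1` (transpositions for
even `n`, `3`-cycles for odd `n`) move it to every elementary matrix.
[cite: MulmuleySohoniSIAM2001, proof of Thm. 4.7 = journal Thm. 4.2 (AV p.15, all.txt L958–962)] -/
theorem MS2001_perStabilizer_irreducible {k : Type*} [Field k] [Infinite k] {n : ℕ}
    (W : Submodule k (Fin n × Fin n → k))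
    (hW : ∀ γ ∈ slSubgroup (Fin n × Fin n) k ⊓ linStabilizer (perPoly (Fin n) k),
      ∀ w ∈ W, (γ : Matrix (Fin n × Fin n) (Fin n × Fin n) k).mulVec w ∈ W) :
    W = ⊥ ∨ W = ⊤ := by
  rcases eq_or_ne W ⊥ with h | h
  · exact Or.inl h
  right
  obtain ⟨w, hw, hw0⟩ := (Submodule.ne_bot_iff W).mp h
  obtain ⟨x₀, hx₀⟩ := Function.ne_iff.mp hw0
  rw [Pi.zero_apply] at hx₀
  have hone : (Pi.single x₀ 1 : Fin n × Fin n → k) ∈ W := by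
    rcases subsingleton_or_nontrivial (Fin n) with hn | hn
    · have hws : (Pi.single x₀ 1 : Fin n × Fin n → k) = (w x₀)⁻¹ • w := by
        funext y
        have : y = x₀ := Subsingleton.elim _ _
        subst this
        simp [inv_mul_cancel₀ hx₀]
      rw [hws]
      exact W.smul_mem _ hw
    · obtain ⟨a₁, ha⟩ := exists_ne x₀.1
      obtain ⟨b₁, hb⟩ := exists_ne x₀.2
      obtain ⟨θ, hθ, hθn⟩ := MS2001CharP.exists_pow_ne_one (k := k) 2
      exact MS2001CharP.single_mem_of_apply_ne_zero_per hW hθ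
        (by simpa using hθn 1 one_pos one_le_two) (hθn 2 two_pos le_rfl) hw hx₀ ha hb
  refine eq_top_of_forall_single_mem fun x => ?_
  have hrow : (Pi.single (x.1, x₀.2) 1 : Fin n × Fin n → k) ∈ W := by
    by_cases hr : x₀.1 = x.1
    · rw [← hr, Prod.mk.eta]; exact hone
    · exact MS2001CharP.single_rowMove_per hW hr (by rw [Prod.mk.eta]; exact hone)
  by_cases hc : x₀.2 = x.2
  · rw [← Prod.mk.eta (p := x), ← hc]; exact hrow
  · exact MS2001CharP.single_colMove_per hW hc hrow

end Literature.Computability.AlgebraicComplexity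

end
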